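import Summits.QuantumFields.YangMills.Theorems.ConvexGribovBodyContinuumLegGivenGapCsclTorusForms
import HarnessLib
import Summits.QuantumFields.YangMills.Theorems.ConvexGribovBodyContinuumLegGivenGapStubRpCoreChord
import Summits.QuantumFields.YangMills.Theorems.ConvexGribovBodyContinuumLegGivenGapStubObsGeometry
import Summits.QuantumFields.YangMills.Theorems.ConvexGribovBodyContinuumLegGivenGapStubRpShift
import Summits.QuantumFields.YangMills.Theorems.ConvexGribovBodyContinuumLegGivenGapStubPairToNorm
import Summits.QuantumFields.YangMills.Theorems.ConvexGribovBodyContinuumLegGivenGapStubBilinearUBP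
import Summits.QuantumFields.YangMills.Theorems.ConvexGribovBodyContinuumLegGivenGapStubOsMatching
import Summits.QuantumFields.YangMills.Theorems.ConvexGribovBodyContinuumLegGivenGapStubCltOfCscl

/-!
# Reshape 17-CS of crux `ContinuumLegGivenGap` (stmt-QuantumFields-15828), line `Sketch`: the CLOSED helper files 2–10 of
# `stub_csclOfLock`, concatenated (lead c5, instance A, 2026-08-17T02:10Z)

This workfile elaborates against the tree (helper 1 `…CsclTorusForms` p136023 and `stub_osMatching` p136156 are landed).
It is the byte-identical concatenation (imports merged, bodies in order) of NINE standalone Theorems files that are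
READY TO LAND as `--supports stmt-QuantumFields-15828` (each has a registered anchor; see `Lines/Sketch17CS-LANDING.md`
for targets, order and the one-line `ledger propose` commands). Instance A of seat c5 cannot propose (its shell is
`operator:` to the gate); any prover seat may land them verbatim. Content: the torus-chord derivation of (CSCL) from the
locked lattice gap + reflection positivity — per-torus theorem `cscl_torus_pair` (OS-norm constants at half rate, the
per-pair constants relegated to a length condition), representatives as species with class supports, Banach–Steinhaus
constants, per-step budget and torus choice, scheme, exact lattice translation, and the reduction of `HasCSClustering`
to the sums inequality. What is NOT here yet: the per-datum core (osMatching + cscl_torus_pair + time rounding), the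
spatial cutoff/continuity layer, and the final `stub_csclOfLock` — in progress in instance A's folder.
-/

-- ═════════════════════════════════════════════════════════════════════════════════════════════
-- FILE: Summits/QuantumFields/YangMills/Theorems/ConvexGribovBodyContinuumLegGivenGapCsclTorusChord.lean
-- (imports of the standalone file: see Lines/Sketch17CS-LANDING.md)
-- ═════════════════════════════════════════════════════════════════════════════════════════════

/-!
# `ContinuumLegGivenGap` (stmt-QuantumFields-15828), line `Sketch`, reshape 17-CS, helper 2 of `stub_csclOfLock`:
# Cauchy–Schwarz of the two forms; the reflected time correlation of a positive-time observable is non-negative and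
# log-convex on the odd torus

Sequel of `…CsclTorusForms`. On the torus of side `2S+1` at `β ≥ 0` (`Ũ = torusLift _ U`, `Θ = gaugeTimeReflect`,
`τᶜ = configShift (−c e₀)`), for bounded measurable complex cylinder observables supported at lattice times in
`[lo, hi]`:
* `cscl_bond_cs`, `cscl_site_cs` — Cauchy–Schwarz and reality/positivity of the diagonal for the bond form
  `∫ conj X(ΘŨ) Y(Ũ)` and the site form `∫ conj X(ΘŨ) Y(τŨ)` (tree `torus_rp_bond` / `torus_rp_site`);
* `cscl_isCylinder_shift` (+ time range of the shifted support), `cscl_timeSupp_finset` (a time range gives a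
  positive-time edge set with controlled `maxTime`);
* `cscl_seq_nonneg`, `cscl_seq_logConvex` — for `A` supported at times in `[0, w]`, the sequence
  `m ↦ P_m(A,A) = ∫ conj A(ΘŨ) A(τᵐŨ)` is real non-negative and log-convex as long as `m + 2w + 6 ≤ 2S`
  (`P_{2a} = Q₀(Aτᵃ, Aτᵃ)`, `P_{2a+1} = Q₁(Aτᵃ, Aτᵃ) = Q₀(Aτᵃ, Aτᵃ⁺¹)`, `P_{2a} = Q₁(Aτᵃ⁻¹, Aτᵃ)` and Cauchy–Schwarz).
Registered anchor: `cscl_anchor_chord`. Refs: Osterwalder–Seiler 1978 §2; Glimm–Jaffe 1987 §6.1. No definitions.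
-/

noncomputable section

open scoped ComplexConjugate
open MeasureTheory Filter
open Literature.MathematicalPhysics.QuantumFieldTheory Literature.MathematicalPhysics.QuantumLattice
open Summit.QuantumFields.YangMills.Theorems.ClusteringToYangMills.Reconstructible
open Summit.QuantumFields.YangMills.Theorems.CriticalContinuumLimit.AdmissibleGap (maxTime torus_rp_bond torus_rp_site)

namespace Summit.QuantumFields.YangMills.Theorems.ContinuumLegGivenGap

section Torus

variable {G : Type} [Group G] [TopologicalSpace G] [IsTopologicalGroup G] [CompactSpace G]
  [MeasurableSpace G] [BorelSpace G] {N : ℕ} (ρ : G →* Matrix (Fin N) (Fin N) ℂ)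

/-- **Cauchy–Schwarz for the bond form** on positive-time cylinder observables (`maxTime + 1 ≤ S`, `S ≥ 1`,
`β ≥ 0`): `‖Q₀(X,Y)‖² ≤ Re Q₀(X,X) · Re Q₀(Y,Y)`, and `Q₀(X,X)` is real `≥ 0`. [folklore] -/
theorem cscl_bond_cs (hρ : Continuous ρ) {β : ℝ} (hβ : 0 ≤ β) {S : ℕ} (hS1 : 1 ≤ S) {X Y : LGConfig 4 G → ℂ}
    (hXm : Measurable X) (hYm : Measurable Y) (hXb : ∃ C : ℝ, ∀ U, ‖X U‖ ≤ C) (hYb : ∃ C : ℝ, ∀ U, ‖Y U‖ ≤ C)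
    {ΛX ΛY : Finset (Literature.MathematicalPhysics.QuantumLattice.ZdEdge 4)} (hX : IsCylinder X ΛX) (hY : IsCylinder Y ΛY)
    (hΛX : (↑ΛX : Set (Literature.MathematicalPhysics.QuantumLattice.ZdEdge 4)) ⊆ posTimeEdges) (hΛY : (↑ΛY : Set (Literature.MathematicalPhysics.QuantumLattice.ZdEdge 4)) ⊆ posTimeEdges)
    (hSX : maxTime ΛX + 1 ≤ S) (hSY : maxTime ΛY + 1 ≤ S) :
    ‖∫ U, conj (X (gaugeTimeReflect (torusLift (2 * S + 1) U))) * Y (torusLift (2 * S + 1) U)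
        ∂(wilsonMeasure (d := 4) (L := 2 * S + 1) ρ β)‖ ^ 2 ≤
      (∫ U, conj (X (gaugeTimeReflect (torusLift (2 * S + 1) U))) * X (torusLift (2 * S + 1) U)
        ∂(wilsonMeasure (d := 4) (L := 2 * S + 1) ρ β)).re *
      (∫ U, conj (Y (gaugeTimeReflect (torusLift (2 * S + 1) U))) * Y (torusLift (2 * S + 1) U)
        ∂(wilsonMeasure (d := 4) (L := 2 * S + 1) ρ β)).re ∧
    0 ≤ (∫ U, conj (X (gaugeTimeReflect (torusLift (2 * S + 1) U))) * X (torusLift (2 * S + 1) U)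
        ∂(wilsonMeasure (d := 4) (L := 2 * S + 1) ρ β)).re ∧
    (∫ U, conj (X (gaugeTimeReflect (torusLift (2 * S + 1) U))) * X (torusLift (2 * S + 1) U)
        ∂(wilsonMeasure (d := 4) (L := 2 * S + 1) ρ β)).im = 0 := by
  refine ⟨?_, torus_rp_bond ρ hρ hβ hS1 hXm hXb hX hΛX hSX, ?_⟩
  · refine cscl_cs_of_psd _ _ _ fun c => ?_
    -- positivity of `Q₀(X + cY, X + cY)`
    obtain ⟨CX, hCX⟩ := hXb
    obtain ⟨CY, hCY⟩ := hYb
    have hFm : Measurable fun V => X V + c * Y V := hXm.add (hYm.const_mul c)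
    have hFb : ∃ C : ℝ, ∀ U, ‖X U + c * Y U‖ ≤ C := ⟨CX + ‖c‖ * CY, fun U =>
      (norm_add_le _ _).trans (add_le_add (hCX U) (by rw [norm_mul]; exact mul_le_mul_of_nonneg_left (hCY U) (norm_nonneg _)))⟩
    have hpos := torus_rp_bond (S := S) ρ hρ hβ hS1 hFm hFb (cscl_isCylinder_add_smul hX hY c)
      (by rw [Finset.coe_union]; exact Set.union_subset hΛX hΛY)
      (by rw [cscl_maxTime_union]; omega)
    have hexp := cscl_form_expand ρ hρ β hXm hYm ⟨CX, hCX⟩ ⟨CY, hCY⟩ c (L := 2 * S + 1) 0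
    simp only [Pi.single_zero, neg_zero, rpShift_configShift_zero] at hexp
    rw [hexp, cscl_bond_herm ρ hρ β (2 * S + 1) X Y, ← map_mul, Complex.conj_mul' c, ← Complex.ofReal_pow] at hpos
    simp only [Complex.add_re, Complex.conj_re, Complex.re_ofReal_mul] at hpos
    linarith
  · have hherm := cscl_bond_herm ρ hρ β (2 * S + 1) X X
    -- `Q = conj Q` forces `Im Q = 0`
    have := congrArg Complex.im hherm
    rw [Complex.conj_im] at this
    linarith

/-- **Cauchy–Schwarz for the site form** on positive-time cylinder observables (`maxTime + 2 ≤ S`, `β ≥ 0`):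
`‖Q₁(X,Y)‖² ≤ Re Q₁(X,X) · Re Q₁(Y,Y)`, and `Q₁(X,X)` is real `≥ 0`. [folklore] -/
theorem cscl_site_cs (hρ : Continuous ρ) {β : ℝ} (hβ : 0 ≤ β) {S : ℕ} {X Y : LGConfig 4 G → ℂ}
    (hXm : Measurable X) (hYm : Measurable Y) (hXb : ∃ C : ℝ, ∀ U, ‖X U‖ ≤ C) (hYb : ∃ C : ℝ, ∀ U, ‖Y U‖ ≤ C)
    {ΛX ΛY : Finset (Literature.MathematicalPhysics.QuantumLattice.ZdEdge 4)} (hX : IsCylinder X ΛX) (hY : IsCylinder Y ΛY)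
    (hΛX : (↑ΛX : Set (Literature.MathematicalPhysics.QuantumLattice.ZdEdge 4)) ⊆ posTimeEdges) (hΛY : (↑ΛY : Set (Literature.MathematicalPhysics.QuantumLattice.ZdEdge 4)) ⊆ posTimeEdges)
    (hSX : maxTime ΛX + 2 ≤ S) (hSY : maxTime ΛY + 2 ≤ S) :
    ‖∫ U, conj (X (gaugeTimeReflect (torusLift (2 * S + 1) U))) * Y (gaugeTimeShift (torusLift (2 * S + 1) U))
        ∂(wilsonMeasure (d := 4) (L := 2 * S + 1) ρ β)‖ ^ 2 ≤
      (∫ U, conj (X (gaugeTimeReflect (torusLift (2 * S + 1) U))) * X (gaugeTimeShift (torusLift (2 * S + 1) U))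
        ∂(wilsonMeasure (d := 4) (L := 2 * S + 1) ρ β)).re *
      (∫ U, conj (Y (gaugeTimeReflect (torusLift (2 * S + 1) U))) * Y (gaugeTimeShift (torusLift (2 * S + 1) U))
        ∂(wilsonMeasure (d := 4) (L := 2 * S + 1) ρ β)).re ∧
    0 ≤ (∫ U, conj (X (gaugeTimeReflect (torusLift (2 * S + 1) U))) * X (gaugeTimeShift (torusLift (2 * S + 1) U))
        ∂(wilsonMeasure (d := 4) (L := 2 * S + 1) ρ β)).re ∧
    (∫ U, conj (X (gaugeTimeReflect (torusLift (2 * S + 1) U))) * X (gaugeTimeShift (torusLift (2 * S + 1) U))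
        ∂(wilsonMeasure (d := 4) (L := 2 * S + 1) ρ β)).im = 0 := by
  refine ⟨?_, torus_rp_site ρ hρ hβ hXm hXb hX hΛX hSX, ?_⟩
  · refine cscl_cs_of_psd _ _ _ fun c => ?_
    obtain ⟨CX, hCX⟩ := hXb
    obtain ⟨CY, hCY⟩ := hYb
    have hFm : Measurable fun V => X V + c * Y V := hXm.add (hYm.const_mul c)
    have hFb : ∃ C : ℝ, ∀ U, ‖X U + c * Y U‖ ≤ C := ⟨CX + ‖c‖ * CY, fun U =>
      (norm_add_le _ _).trans (add_le_add (hCX U) (by rw [norm_mul]; exact mul_le_mul_of_nonneg_left (hCY U) (norm_nonneg _)))⟩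
    have hpos := torus_rp_site (S := S) ρ hρ hβ hFm hFb (cscl_isCylinder_add_smul hX hY c)
      (by rw [Finset.coe_union]; exact Set.union_subset hΛX hΛY)
      (by rw [cscl_maxTime_union]; omega)
    have hexp := cscl_form_expand ρ hρ β hXm hYm ⟨CX, hCX⟩ ⟨CY, hCY⟩ c (L := 2 * S + 1) 1
    have hτ : ∀ W : LGConfig 4 G, configShift (-(Pi.single 0 (1 : ℤ))) W = gaugeTimeShift W := fun W => rfl
    simp only [hτ] at hexp
    rw [hexp, cscl_site_herm ρ hρ β (2 * S + 1) X Y, ← map_mul, Complex.conj_mul' c, ← Complex.ofReal_pow] at hpos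
    simp only [Complex.add_re, Complex.conj_re, Complex.re_ofReal_mul] at hpos
    linarith
  · have hherm := cscl_site_herm ρ hρ β (2 * S + 1) X X
    have := congrArg Complex.im hherm
    rw [Complex.conj_im] at this
    linarith


/-! ### Shifted supports and time ranges -/

omit [Group G] [TopologicalSpace G] [IsTopologicalGroup G] [CompactSpace G] [BorelSpace G] in
/-- **A time translate of a cylinder observable is a cylinder observable on the translated edges**, and a time
range `[lo, hi]` of the support becomes `[lo + c, hi + c]`. [folklore] -/
theorem cscl_isCylinder_shift {X : LGConfig 4 G → ℂ} {Λ : Finset (Literature.MathematicalPhysics.QuantumLattice.ZdEdge 4)}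
    (hX : IsCylinder X Λ) (c : ℤ) {lo hi : ℤ} (hΛ : ∀ e ∈ Λ, lo ≤ e.1 0 ∧ e.1 0 ≤ hi) :
    ∃ Λ' : Finset (Literature.MathematicalPhysics.QuantumLattice.ZdEdge 4),
      IsCylinder (fun V => X (configShift (-(Pi.single 0 c)) V)) Λ' ∧
        ∀ e ∈ Λ', lo + c ≤ e.1 0 ∧ e.1 0 ≤ hi + c := by
  refine ⟨Λ.image fun e => (e.1 + Pi.single 0 c, e.2), ?_, ?_⟩
  · intro U V hUV
    refine hX fun e he => ?_
    simp only [Literature.MathematicalPhysics.QuantumLattice.configShift_apply]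
    have h1 : e.1 - -(Pi.single 0 c : Literature.Probability.LatticeModels.Site 4) = e.1 + Pi.single 0 c := by
      funext j; simp
    rw [h1]
    exact hUV _ (Finset.mem_coe.2 (Finset.mem_image_of_mem _ (Finset.mem_coe.1 he)))
  · intro e he
    obtain ⟨e', he', rfl⟩ := Finset.mem_image.1 he
    have h := hΛ e' he'
    simp only [Pi.add_apply, Pi.single_eq_same]
    omega

omit [TopologicalSpace G] [IsTopologicalGroup G] [CompactSpace G] [BorelSpace G] in
/-- A support with times in `[lo, hi]`, `0 ≤ lo`, is a positive-time edge set of `maxTime ≤ hi`. [folklore] -/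
theorem cscl_timeSupp_finset {Λ : Finset (Literature.MathematicalPhysics.QuantumLattice.ZdEdge 4)} {lo hi : ℤ}
    (hΛ : ∀ e ∈ Λ, lo ≤ e.1 0 ∧ e.1 0 ≤ hi) (hlo : 0 ≤ lo) :
    (↑Λ : Set (Literature.MathematicalPhysics.QuantumLattice.ZdEdge 4)) ⊆ posTimeEdges ∧ (maxTime Λ : ℤ) ≤ max hi 0 := by
  refine ⟨fun e he => ?_, ?_⟩
  · have h := hΛ e (Finset.mem_coe.1 he)
    show 0 ≤ e.1 0
    omega
  · unfold maxTime
    have : Λ.sup (fun e => (e.1 0).toNat) ≤ (max hi 0).toNat := Finset.sup_le fun e he => by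
      have h := hΛ e he
      omega
    have h2 : ((max hi 0).toNat : ℤ) = max hi 0 := Int.toNat_of_nonneg (le_max_right _ _)
    omega

/-! ### The reflected time correlation of one observable: reality, positivity, log-convexity -/

/-- **Reality and positivity**: for `A` supported at times in `[0, w]` and `m + 2w + 6 ≤ 2S`, the pairing
`P_m(A,A) = ∫ conj A(ΘŨ) A(τᵐŨ)` is real and non-negative (`P_{2a} = Q₀(Aτᵃ,Aτᵃ)`, `P_{2a+1} = Q₁(Aτᵃ,Aτᵃ)`).
[folklore] -/
theorem cscl_seq_nonneg (hρ : Continuous ρ) {β : ℝ} (hβ : 0 ≤ β) {S w : ℕ} {A : LGConfig 4 G → ℂ}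
    (hAm : Measurable A) (hAb : ∃ C : ℝ, ∀ U, ‖A U‖ ≤ C) {Λ : Finset (Literature.MathematicalPhysics.QuantumLattice.ZdEdge 4)}
    (hA : IsCylinder A Λ) (hΛ : ∀ e ∈ Λ, 0 ≤ e.1 0 ∧ e.1 0 ≤ (w : ℤ)) (m : ℕ) (hm : m + 2 * w + 6 ≤ 2 * S) :
    0 ≤ (∫ U, conj (A (gaugeTimeReflect (torusLift (2 * S + 1) U))) *
        A (configShift (-(Pi.single 0 (m : ℤ))) (torusLift (2 * S + 1) U)) ∂(wilsonMeasure (d := 4) (L := 2 * S + 1) ρ β)).re ∧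
    (∫ U, conj (A (gaugeTimeReflect (torusLift (2 * S + 1) U))) *
        A (configShift (-(Pi.single 0 (m : ℤ))) (torusLift (2 * S + 1) U)) ∂(wilsonMeasure (d := 4) (L := 2 * S + 1) ρ β)).im = 0 := by
  have hS1 : 1 ≤ S := by omega
  obtain ⟨C, hC⟩ := hAb
  -- `m = 2a` or `m = 2a + 1`
  obtain ⟨a, ha⟩ := Nat.even_or_odd' m
  -- the shifted observable `A ∘ τᵃ`
  obtain ⟨Λa, hAa, hΛa⟩ := cscl_isCylinder_shift hA (a : ℤ) hΛ
  have hAam : Measurable fun V => A (configShift (-(Pi.single 0 (a : ℤ))) V) := hAm.comp (configShift _).measurable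
  have hAab : ∃ C : ℝ, ∀ U, ‖A (configShift (-(Pi.single 0 (a : ℤ))) U)‖ ≤ C := ⟨C, fun U => hC _⟩
  obtain ⟨hpos, hmax⟩ := cscl_timeSupp_finset hΛa (by omega)
  rcases ha with rfl | rfl
  · -- even: bond form of `A ∘ τᵃ`
    have hSX : maxTime Λa + 1 ≤ S := by
      have : (maxTime Λa : ℤ) ≤ max ((w : ℤ) + a) 0 := hmax
      omega
    obtain ⟨-, h0, him⟩ := cscl_bond_cs ρ hρ hβ hS1 hAam hAam hAab hAab hAa hAa hpos hpos hSX hSX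
    have hshift := cscl_shift_pair ρ β (2 * S + 1) A A (a : ℤ) (a : ℤ)
    have hcast : ((a : ℤ) + a) = ((2 * a : ℕ) : ℤ) := by push_cast; ring
    rw [hcast] at hshift
    rw [← hshift]
    exact ⟨h0, him⟩
  · -- odd: site form of `A ∘ τᵃ`
    have hSX : maxTime Λa + 2 ≤ S := by
      have : (maxTime Λa : ℤ) ≤ max ((w : ℤ) + a) 0 := hmax
      omega
    obtain ⟨-, h0, him⟩ := cscl_site_cs ρ hρ hβ hAam hAam hAab hAab hAa hAa hpos hpos hSX hSX
    have hshift := cscl_shift_pair ρ β (2 * S + 1) A A (a : ℤ) ((a : ℤ) + 1)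
    have hcast : ((a : ℤ) + (a + 1)) = ((2 * a + 1 : ℕ) : ℤ) := by push_cast; ring
    rw [hcast] at hshift
    have hτ : ∀ W : LGConfig 4 G, configShift (-(Pi.single 0 ((a : ℤ) + 1))) W =
        configShift (-(Pi.single 0 (a : ℤ))) (gaugeTimeShift W) := fun W =>
      (rpShift_configShift_gaugeTimeShift (a : ℤ) W).symm
    simp only [hτ] at hshift
    rw [← hshift]
    exact ⟨h0, him⟩

/-- **Log-convexity**: for `A` supported at times in `[0, w]`, `1 ≤ m` and `m + 2w + 7 ≤ 2S`,
`(Re P_m)² ≤ Re P_{m−1} · Re P_{m+1}` (`P_{2a+1} = Q₀(Aτᵃ, Aτᵃ⁺¹)`, `P_{2a} = Q₁(Aτᵃ⁻¹, Aτᵃ)`, Cauchy–Schwarz).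
[folklore] -/
theorem cscl_seq_logConvex (hρ : Continuous ρ) {β : ℝ} (hβ : 0 ≤ β) {S w : ℕ} {A : LGConfig 4 G → ℂ}
    (hAm : Measurable A) (hAb : ∃ C : ℝ, ∀ U, ‖A U‖ ≤ C) {Λ : Finset (Literature.MathematicalPhysics.QuantumLattice.ZdEdge 4)}
    (hA : IsCylinder A Λ) (hΛ : ∀ e ∈ Λ, 0 ≤ e.1 0 ∧ e.1 0 ≤ (w : ℤ)) (m : ℕ) (hm1 : 1 ≤ m)
    (hm : m + 2 * w + 7 ≤ 2 * S) :
    (∫ U, conj (A (gaugeTimeReflect (torusLift (2 * S + 1) U))) *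
        A (configShift (-(Pi.single 0 (m : ℤ))) (torusLift (2 * S + 1) U)) ∂(wilsonMeasure (d := 4) (L := 2 * S + 1) ρ β)).re ^ 2 ≤
      (∫ U, conj (A (gaugeTimeReflect (torusLift (2 * S + 1) U))) *
        A (configShift (-(Pi.single 0 ((m - 1 : ℕ) : ℤ))) (torusLift (2 * S + 1) U)) ∂(wilsonMeasure (d := 4) (L := 2 * S + 1) ρ β)).re *
      (∫ U, conj (A (gaugeTimeReflect (torusLift (2 * S + 1) U))) *
        A (configShift (-(Pi.single 0 ((m + 1 : ℕ) : ℤ))) (torusLift (2 * S + 1) U)) ∂(wilsonMeasure (d := 4) (L := 2 * S + 1) ρ β)).re := by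
  have hS1 : 1 ≤ S := by omega
  obtain ⟨C, hC⟩ := hAb
  have hshm : ∀ b : ℤ, Measurable fun V => A (configShift (-(Pi.single 0 b)) V) := fun b =>
    hAm.comp (configShift _).measurable
  have hshb : ∀ b : ℤ, ∃ C : ℝ, ∀ U, ‖A (configShift (-(Pi.single 0 b)) U)‖ ≤ C := fun b => ⟨C, fun U => hC _⟩
  -- reality of `P_m` (to convert `‖P_m‖² = (Re P_m)²`)
  have hreal := (cscl_seq_nonneg (S := S) ρ hρ hβ hAm ⟨C, hC⟩ hA hΛ m (by omega)).2
  have hnorm : ∀ z : ℂ, z.im = 0 → ‖z‖ ^ 2 = z.re ^ 2 := fun z hz => by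
    rw [Complex.sq_norm, Complex.normSq_apply, hz]; ring
  obtain ⟨a, ha⟩ := Nat.even_or_odd' m
  rcases ha with rfl | rfl
  · -- `m = 2a`, `a ≥ 1`: site form of `(Aτ^{a-1}, Aτᵃ)`
    have ha1 : 1 ≤ a := by omega
    obtain ⟨Λ1, hA1, hΛ1⟩ := cscl_isCylinder_shift hA ((a : ℤ) - 1) hΛ
    obtain ⟨Λ2, hA2, hΛ2⟩ := cscl_isCylinder_shift hA (a : ℤ) hΛ
    obtain ⟨hpos1, hmax1⟩ := cscl_timeSupp_finset hΛ1 (by omega)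
    obtain ⟨hpos2, hmax2⟩ := cscl_timeSupp_finset hΛ2 (by omega)
    have hS1' : maxTime Λ1 + 2 ≤ S := by
      have : (maxTime Λ1 : ℤ) ≤ max ((w : ℤ) + (a - 1)) 0 := hmax1
      omega
    have hS2' : maxTime Λ2 + 2 ≤ S := by
      have : (maxTime Λ2 : ℤ) ≤ max ((w : ℤ) + a) 0 := hmax2
      omega
    obtain ⟨hcs, -, -⟩ := cscl_site_cs ρ hρ hβ (hshm _) (hshm _) (hshb _) (hshb _) hA1 hA2 hpos1 hpos2 hS1' hS2'
    -- identify the three pairings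
    have e12 := cscl_shift_pair ρ β (2 * S + 1) A A ((a : ℤ) - 1) ((a : ℤ) + 1)
    have e11 := cscl_shift_pair ρ β (2 * S + 1) A A ((a : ℤ) - 1) ((a : ℤ) - 1 + 1)
    have e22 := cscl_shift_pair ρ β (2 * S + 1) A A (a : ℤ) ((a : ℤ) + 1)
    have hτ : ∀ (b : ℤ) (W : LGConfig 4 G), configShift (-(Pi.single 0 (b + 1))) W =
        configShift (-(Pi.single 0 b)) (gaugeTimeShift W) := fun b W =>
      (rpShift_configShift_gaugeTimeShift b W).symm
    simp only [hτ] at e12 e11 e22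
    have c12 : ((a : ℤ) - 1 + (a + 1)) = ((2 * a : ℕ) : ℤ) := by push_cast; ring
    have c11 : ((a : ℤ) - 1 + (a - 1 + 1)) = ((2 * a - 1 : ℕ) : ℤ) := by
      rw [Nat.cast_sub (by omega)]; push_cast; ring
    have c22 : ((a : ℤ) + (a + 1)) = ((2 * a + 1 : ℕ) : ℤ) := by push_cast; ring
    rw [c12] at e12; rw [c11] at e11; rw [c22] at e22
    rw [e12, e11, e22] at hcs
    rwa [hnorm _ hreal] at hcs
  · -- `m = 2a+1`: bond form of `(Aτᵃ, Aτᵃ⁺¹)`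
    obtain ⟨Λ1, hA1, hΛ1⟩ := cscl_isCylinder_shift hA (a : ℤ) hΛ
    obtain ⟨Λ2, hA2, hΛ2⟩ := cscl_isCylinder_shift hA ((a : ℤ) + 1) hΛ
    obtain ⟨hpos1, hmax1⟩ := cscl_timeSupp_finset hΛ1 (by omega)
    obtain ⟨hpos2, hmax2⟩ := cscl_timeSupp_finset hΛ2 (by omega)
    have hS1' : maxTime Λ1 + 1 ≤ S := by
      have : (maxTime Λ1 : ℤ) ≤ max ((w : ℤ) + a) 0 := hmax1
      omega
    have hS2' : maxTime Λ2 + 1 ≤ S := by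
      have : (maxTime Λ2 : ℤ) ≤ max ((w : ℤ) + (a + 1)) 0 := hmax2
      omega
    obtain ⟨hcs, -, -⟩ := cscl_bond_cs ρ hρ hβ hS1 (hshm _) (hshm _) (hshb _) (hshb _) hA1 hA2 hpos1 hpos2 hS1' hS2'
    have e12 := cscl_shift_pair ρ β (2 * S + 1) A A (a : ℤ) ((a : ℤ) + 1)
    have e11 := cscl_shift_pair ρ β (2 * S + 1) A A (a : ℤ) (a : ℤ)
    have e22 := cscl_shift_pair ρ β (2 * S + 1) A A ((a : ℤ) + 1) ((a : ℤ) + 1)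
    have c12 : ((a : ℤ) + (a + 1)) = ((2 * a + 1 : ℕ) : ℤ) := by push_cast; ring
    have c11 : ((a : ℤ) + a) = ((2 * a + 1 - 1 : ℕ) : ℤ) := by
      rw [Nat.add_sub_cancel]; push_cast; ring
    have c22 : ((a : ℤ) + 1 + (a + 1)) = ((2 * a + 1 + 1 : ℕ) : ℤ) := by push_cast; ring
    rw [c12] at e12; rw [c11] at e11; rw [c22] at e22
    rw [e12, e11, e22] at hcs
    rwa [hnorm _ hreal] at hcs

end Torus

/-- **Registered anchor of this file** (closed form of `cscl_timeSupp_finset`'s first half, for the gate's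
`--supports` stub check). [folklore] -/
theorem cscl_anchor_chord :
    ∀ (Λ : Finset (Literature.MathematicalPhysics.QuantumLattice.ZdEdge 4)) (lo hi : ℤ),
      (∀ e ∈ Λ, lo ≤ e.1 0 ∧ e.1 0 ≤ hi) → 0 ≤ lo →
        (↑Λ : Set (Literature.MathematicalPhysics.QuantumLattice.ZdEdge 4)) ⊆ posTimeEdges :=
  fun _ _ _ hΛ hlo => (cscl_timeSupp_finset hΛ hlo).1

end Summit.QuantumFields.YangMills.Theorems.ContinuumLegGivenGap

end


-- ═════════════════════════════════════════════════════════════════════════════════════════════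
-- FILE: Summits/QuantumFields/YangMills/Theorems/ConvexGribovBodyContinuumLegGivenGapCsclChordSlack.lean
-- (imports of the standalone file: see Lines/Sketch17CS-LANDING.md)
-- ═════════════════════════════════════════════════════════════════════════════════════════════

/-!
# `ContinuumLegGivenGap` (stmt-QuantumFields-15828), line `Sketch`, reshape 17-CS, helper 3 of `stub_csclOfLock`:
# the log-convex chord with slack; centring; Cauchy–Schwarz clustering with OS norms on ONE odd torus

Sequel of `…CsclTorusChord`. `cscl_chord_slack`: a non-negative log-convex sequence on `0 … N` with
`g N ≤ D e^{−μN}` and `D ≤ ε e^{μN/2}` satisfies `g n ≤ g 0 · e^{−μn/2} + ε` (case split `g 0 ≶ ε` over the landed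
`rpCore_chordBound`). `cscl_centre_identity`: `∫ conj X°(ΘŨ) Y°(τˢŨ) = ∫ conj X(ΘŨ) Y(τˢŨ) − conj ⟨X⟩ ⟨Y⟩` for the centred
observables. `cscl_torus_pair` — THE PER-TORUS STATEMENT: on the torus of side `2S+1` (`β ≥ 0`), for bounded measurable
complex cylinder observables `X, Y` supported at lattice times in `[1, w]`, if the reflected connected time correlations
of `X` with itself and of `Y` with itself are `≤ D e^{−Mn}` for all `n ≤ S` (per-observable constants — the locked lattice
gap) and the torus is long enough (`2w + N + 10 ≤ S`, `D e^{M} ≤ ε e^{MN/2}`), then for every shift `s ≤ N` the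
`cfgReflect`-pairing `∫ conj X(cfgReflect Ũ) Y(τˢŨ) − conj ⟨X⟩⟨Y⟩` is bounded by
`e^{−Ms/2} √V_X √V_Y + √ε (√V_X + √V_Y) + ε` with the (uncentred, site-form) OS variances `V_X = Re ∫ conj X(cfgReflect Ũ) X(Ũ)`:
OS-NORM constants at half rate, the per-observable constants relegated to the length condition.
Registered anchor: `cscl_anchor_slack`. Refs: Osterwalder–Seiler 1978 §2; Glimm–Jaffe 1987 §6.1. No definitions.
-/

noncomputable section

open scoped ComplexConjugate
open MeasureTheory Filter
open Literature.MathematicalPhysics.QuantumFieldTheory Literature.MathematicalPhysics.QuantumLattice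
open Summit.QuantumFields.YangMills.Theorems.ClusteringToYangMills.Reconstructible
open Summit.QuantumFields.YangMills.Theorems.CriticalContinuumLimit.AdmissibleGap (maxTime)

namespace Summit.QuantumFields.YangMills.Theorems.ContinuumLegGivenGap

/-! ### The log-convex chord with slack -/

/-- **Chord with slack.** For a non-negative sequence on `0, …, N` (`N > 0`), log-convex at interior indices, with
`g N ≤ D e^{−μN}` (`0 ≤ μ`, `0 < D`) and `D ≤ ε e^{μN/2}` (`0 < ε`): `g n ≤ g 0 · e^{−μn/2} + ε` for all `n ≤ N`.
[folklore] -/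
theorem cscl_chord_slack (g : ℕ → ℝ) (N : ℕ) (D μ ε : ℝ) (hN : 0 < N) (hμ : 0 ≤ μ) (hD : 0 < D) (hε : 0 < ε)
    (hpos : ∀ n : ℕ, n ≤ N → 0 ≤ g n)
    (hlc : ∀ n : ℕ, 1 ≤ n → n + 1 ≤ N → g n ^ 2 ≤ g (n - 1) * g (n + 1))
    (hNb : g N ≤ D * Real.exp (-(μ * N))) (hDε : D ≤ ε * Real.exp (μ * N / 2)) :
    ∀ n : ℕ, n ≤ N → g n ≤ g 0 * Real.exp (-(μ * n / 2)) + ε := by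
  intro n hn
  have hNr : (0 : ℝ) < N := by exact_mod_cast hN
  have hg0 := hpos 0 (Nat.zero_le _)
  have hexpn : 0 ≤ Real.exp (-(μ * n / 2)) := (Real.exp_pos _).le
  -- rescale by `c := max (g 0) ε > 0`
  set c : ℝ := max (g 0) ε with hc
  have hc0 : 0 < c := lt_max_of_lt_right hε
  have hcg : g 0 ≤ c := le_max_left _ _
  have hcε : ε ≤ c := le_max_right _ _
  set D' : ℝ := max (D / c) 1 with hD'
  have hD'1 : 1 ≤ D' := le_max_right _ _
  have hchord := rpCore_chordBound (fun k => g k / c) N 1 D' μ hN le_rfl hD'1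
    (fun k hk => div_nonneg (hpos k hk) hc0.le)
    (fun k hk1 hk2 => by
      have h := hlc k hk1 hk2
      rw [div_pow, div_mul_div_comm, ← sq]
      exact div_le_div_of_nonneg_right h (sq_nonneg _))
    (by rw [div_le_one hc0]; exact hcg)
    (by
      rw [div_le_iff₀ hc0]
      calc g N ≤ D * Real.exp (-(μ * N)) := hNb
        _ = D / c * Real.exp (-(μ * N)) * c := by field_simp
        _ ≤ D' * Real.exp (-(μ * N)) * c := by gcongr; exact le_max_left _ _)
    n hn
  -- `log D' / N ≤ μ / 2`
  have hlogD' : Real.log D' ≤ μ * N / 2 := by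
    rcases le_or_gt (D / c) 1 with h1 | h1
    · rw [hD', max_eq_right h1, Real.log_one]; positivity
    · rw [hD', max_eq_left h1.le]
      have h2 : D / c ≤ Real.exp (μ * N / 2) := by
        rw [div_le_iff₀ hc0]
        calc D ≤ ε * Real.exp (μ * N / 2) := hDε
          _ ≤ c * Real.exp (μ * N / 2) := by gcongr
          _ = Real.exp (μ * N / 2) * c := mul_comm _ _
      calc Real.log (D / c) ≤ Real.log (Real.exp (μ * N / 2)) := Real.log_le_log (by positivity) h2
        _ = μ * N / 2 := Real.log_exp _
  have hexp : Real.exp (-(μ * n) + Real.log D' / N * n) ≤ Real.exp (-(μ * n / 2)) := by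
    refine Real.exp_le_exp.2 ?_
    have h3 : Real.log D' / N * n ≤ μ / 2 * n := by
      refine mul_le_mul_of_nonneg_right ?_ (Nat.cast_nonneg n)
      rw [div_le_iff₀ hNr]; linarith
    linarith
  have hmain : g n ≤ c * Real.exp (-(μ * n / 2)) := by
    have h4 : g n / c ≤ 1 * Real.exp (-(μ * n) + Real.log D' / N * n) := hchord
    rw [div_le_iff₀ hc0, one_mul] at h4
    calc g n ≤ Real.exp (-(μ * n) + Real.log D' / N * n) * c := h4
      _ ≤ Real.exp (-(μ * n / 2)) * c := by gcongr
      _ = c * Real.exp (-(μ * n / 2)) := mul_comm _ _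
  -- case split on which of `g 0`, `ε` is the max
  rcases le_total (g 0) ε with h5 | h5
  · have : c = ε := by rw [hc, max_eq_right h5]
    rw [this] at hmain
    have h6 : ε * Real.exp (-(μ * n / 2)) ≤ ε :=
      mul_le_of_le_one_right hε.le (Real.exp_le_one_iff.2 (by
        have : 0 ≤ μ * n / 2 := by positivity
        linarith))
    nlinarith [mul_nonneg hg0 hexpn]
  · have : c = g 0 := by rw [hc, max_eq_left h5]
    rw [this] at hmain
    linarith

/-- Elementary: `√((a + ε)(b + ε)) ≤ √a √b + √ε (√a + √b) + ε` for non-negative reals. [folklore] -/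
theorem cscl_sqrt_slack {a b ε : ℝ} (ha : 0 ≤ a) (hb : 0 ≤ b) (hε : 0 ≤ ε) :
    Real.sqrt ((a + ε) * (b + ε)) ≤ Real.sqrt a * Real.sqrt b + Real.sqrt ε * (Real.sqrt a + Real.sqrt b) + ε := by
  rw [Real.sqrt_le_left (by positivity)]
  have hsa := Real.sq_sqrt ha
  have hsb := Real.sq_sqrt hb
  have hse := Real.sq_sqrt hε
  nlinarith [Real.sqrt_nonneg a, Real.sqrt_nonneg b, Real.sqrt_nonneg ε,
    mul_nonneg (Real.sqrt_nonneg a) (Real.sqrt_nonneg b), mul_nonneg (Real.sqrt_nonneg a) (Real.sqrt_nonneg ε),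
    mul_nonneg (Real.sqrt_nonneg b) (Real.sqrt_nonneg ε),
    mul_nonneg (mul_nonneg (Real.sqrt_nonneg a) (Real.sqrt_nonneg b)) (Real.sqrt_nonneg ε)]

section Torus

variable {G : Type} [Group G] [TopologicalSpace G] [IsTopologicalGroup G] [CompactSpace G]
  [MeasurableSpace G] [BorelSpace G] {N : ℕ} (ρ : G →* Matrix (Fin N) (Fin N) ℂ)

/-! ### Centring -/

/-- **Centring identity**: with `⟨X⟩ = ∫ X(Ũ)`, `X° = X − ⟨X⟩`,
`∫ conj X°(ΘŨ) Y°(τˢŨ) = ∫ conj X(ΘŨ) Y(τˢŨ) − conj ⟨X⟩ · ⟨Y⟩` (reflection and translation invariance). [folklore] -/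
theorem cscl_centre_identity (hρ : Continuous ρ) (β : ℝ) (L : ℕ) [NeZero L] {X Y : LGConfig 4 G → ℂ}
    (hXm : Measurable X) (hYm : Measurable Y) (hXb : ∃ C : ℝ, ∀ U, ‖X U‖ ≤ C) (hYb : ∃ C : ℝ, ∀ U, ‖Y U‖ ≤ C) (s : ℤ) :
    ∫ U, conj (X (gaugeTimeReflect (torusLift L U)) - ∫ V, X (torusLift L V) ∂(wilsonMeasure (d := 4) (L := L) ρ β)) *
        (Y (configShift (-(Pi.single 0 s)) (torusLift L U)) - ∫ V, Y (torusLift L V) ∂(wilsonMeasure (d := 4) (L := L) ρ β))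
        ∂(wilsonMeasure (d := 4) (L := L) ρ β) =
      (∫ U, conj (X (gaugeTimeReflect (torusLift L U))) * Y (configShift (-(Pi.single 0 s)) (torusLift L U))
        ∂(wilsonMeasure (d := 4) (L := L) ρ β)) -
        conj (∫ V, X (torusLift L V) ∂(wilsonMeasure (d := 4) (L := L) ρ β)) *
          ∫ V, Y (torusLift L V) ∂(wilsonMeasure (d := 4) (L := L) ρ β) := by
  haveI := isProbabilityMeasure_wilsonMeasure (d := 4) (L := L) ρ hρ β
  set mX : ℂ := ∫ V, X (torusLift L V) ∂(wilsonMeasure (d := 4) (L := L) ρ β)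
  set mY : ℂ := ∫ V, Y (torusLift L V) ∂(wilsonMeasure (d := 4) (L := L) ρ β)
  obtain ⟨CX, hCX⟩ := hXb
  obtain ⟨CY, hCY⟩ := hYb
  have hIXY : Integrable (fun U : GaugeConfig 4 L G => conj (X (gaugeTimeReflect (torusLift L U))) *
      Y (configShift (-(Pi.single 0 s)) (torusLift L U))) (wilsonMeasure (d := 4) (L := L) ρ β) := by
    refine cscl_integrable ρ hρ β ((Complex.continuous_conj.measurable.comp (cscl_measurable_comp hXm L s).1).mul
      (cscl_measurable_comp hYm L s).2) ⟨CX * CY, fun U => ?_⟩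
    rw [norm_mul, Complex.norm_conj]
    have hCX0 : 0 ≤ CX := (norm_nonneg _).trans (hCX (gaugeTimeReflect (torusLift L U)))
    exact mul_le_mul (hCX _) (hCY _) (norm_nonneg _) hCX0
  have hIX : Integrable (fun U : GaugeConfig 4 L G => conj (X (gaugeTimeReflect (torusLift L U))))
      (wilsonMeasure (d := 4) (L := L) ρ β) :=
    cscl_integrable ρ hρ β (Complex.continuous_conj.measurable.comp (cscl_measurable_comp hXm L s).1)
      ⟨CX, fun U => by rw [Complex.norm_conj]; exact hCX _⟩
  have hIY : Integrable (fun U : GaugeConfig 4 L G => Y (configShift (-(Pi.single 0 s)) (torusLift L U)))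
      (wilsonMeasure (d := 4) (L := L) ρ β) :=
    cscl_integrable ρ hρ β (cscl_measurable_comp hYm L s).2 ⟨CY, fun U => hCY _⟩
  -- the two one-point integrals
  have h1 : ∫ U, conj (X (gaugeTimeReflect (torusLift L U))) ∂(wilsonMeasure (d := 4) (L := L) ρ β) = conj mX := by
    rw [integral_conj]
    congr 1
    exact cscl_integral_reflect_swap ρ hρ β L fun A _ => X A
  have h2 : ∫ U, Y (configShift (-(Pi.single 0 s)) (torusLift L U)) ∂(wilsonMeasure (d := 4) (L := L) ρ β) = mY :=
    cscl_integral_shift ρ β L _ Y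
  have hpt : ∀ U : GaugeConfig 4 L G,
      conj (X (gaugeTimeReflect (torusLift L U)) - mX) * (Y (configShift (-(Pi.single 0 s)) (torusLift L U)) - mY) =
      conj (X (gaugeTimeReflect (torusLift L U))) * Y (configShift (-(Pi.single 0 s)) (torusLift L U)) -
        mY * conj (X (gaugeTimeReflect (torusLift L U))) -
        conj mX * Y (configShift (-(Pi.single 0 s)) (torusLift L U)) + conj mX * mY := by
    intro U; simp only [map_sub]; ring
  simp_rw [hpt]
  have hI1 : Integrable (fun U : GaugeConfig 4 L G => mY * conj (X (gaugeTimeReflect (torusLift L U))))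
      (wilsonMeasure (d := 4) (L := L) ρ β) := hIX.const_mul mY
  have hI2 : Integrable (fun U : GaugeConfig 4 L G => conj mX * Y (configShift (-(Pi.single 0 s)) (torusLift L U)))
      (wilsonMeasure (d := 4) (L := L) ρ β) := hIY.const_mul (conj mX)
  have hI3 : Integrable (fun U : GaugeConfig 4 L G =>
      conj (X (gaugeTimeReflect (torusLift L U))) * Y (configShift (-(Pi.single 0 s)) (torusLift L U)) -
        mY * conj (X (gaugeTimeReflect (torusLift L U)))) (wilsonMeasure (d := 4) (L := L) ρ β) := hIXY.sub hI1
  have hI4 : Integrable (fun U : GaugeConfig 4 L G =>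
      conj (X (gaugeTimeReflect (torusLift L U))) * Y (configShift (-(Pi.single 0 s)) (torusLift L U)) -
        mY * conj (X (gaugeTimeReflect (torusLift L U))) -
        conj mX * Y (configShift (-(Pi.single 0 s)) (torusLift L U))) (wilsonMeasure (d := 4) (L := L) ρ β) :=
    hI3.sub hI2
  rw [integral_add hI4 (integrable_const _), integral_sub hI3 hI2, integral_sub hIXY hI1, integral_const_mul,
    integral_const_mul, h1, h2, integral_const, probReal_univ, one_smul]
  ring

/-! ### One observable: positivity, log-convexity and the chord for the centred, back-shifted sequence -/

/-- **The chord for one observable.** For a bounded measurable cylinder observable `X` supported at lattice times in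
`[1, w]` whose reflected connected time correlation with itself is `≤ D e^{−Mn}` for all `n ≤ S` on the torus of side
`2S+1` (`β ≥ 0`, `2w + N + 10 ≤ S`, `D e^{M} ≤ ε e^{MN/2}`), the sequence `m ↦ P_m(X',X')` of the centred back-shifted
observable `X' = X∘τ⁻¹ − ⟨X⟩` (`P_m(A,B) = ∫ conj A(ΘŨ) B(τᵐŨ)`) is real non-negative for `m ≤ N + 2`, and
`Re P_{n+1}(X',X') ≤ V_X e^{−Mn/2} + ε` for `n ≤ N`, `V_X = Re ∫ conj X(cfgReflect Ũ) X(Ũ) ≥ 0`. [folklore] -/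
theorem cscl_obs_chord (hρ : Continuous ρ) {β : ℝ} (hβ : 0 ≤ β) {S w Nn : ℕ} {X : LGConfig 4 G → ℂ}
    (hXm : Measurable X) (hXb : ∃ C : ℝ, ∀ U, ‖X U‖ ≤ C)
    {ΛX : Finset (Literature.MathematicalPhysics.QuantumLattice.ZdEdge 4)} (hX : IsCylinder X ΛX)
    (hΛX : ∀ e ∈ ΛX, 1 ≤ e.1 0 ∧ e.1 0 ≤ (w : ℤ)) {M ε DX : ℝ} (hM : 0 ≤ M) (hε : 0 < ε) (hDX : 0 < DX)
    (hNn : 1 ≤ Nn) (hwin : 2 * w + Nn + 10 ≤ S)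
    (hcl : ∀ n : ℕ, n ≤ S →
      ‖(∫ U, conj (X (gaugeTimeReflect (torusLift (2 * S + 1) U))) *
          X (configShift (-(Pi.single 0 (n : ℤ))) (torusLift (2 * S + 1) U)) ∂(wilsonMeasure (d := 4) (L := 2 * S + 1) ρ β)) -
        conj (∫ V, X (torusLift (2 * S + 1) V) ∂(wilsonMeasure (d := 4) (L := 2 * S + 1) ρ β)) *
          ∫ V, X (torusLift (2 * S + 1) V) ∂(wilsonMeasure (d := 4) (L := 2 * S + 1) ρ β)‖ ≤ DX * Real.exp (-(M * n)))
    (hthr : DX * Real.exp M ≤ ε * Real.exp (M * Nn / 2)) :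
    (∀ m : ℕ, m ≤ Nn + 2 →
      0 ≤ (∫ U, conj (X (configShift (-(Pi.single 0 (-1))) (gaugeTimeReflect (torusLift (2 * S + 1) U))) -
              ∫ V, X (torusLift (2 * S + 1) V) ∂(wilsonMeasure (d := 4) (L := 2 * S + 1) ρ β)) *
            (X (configShift (-(Pi.single 0 (-1))) (configShift (-(Pi.single 0 (m : ℤ))) (torusLift (2 * S + 1) U))) -
              ∫ V, X (torusLift (2 * S + 1) V) ∂(wilsonMeasure (d := 4) (L := 2 * S + 1) ρ β))
          ∂(wilsonMeasure (d := 4) (L := 2 * S + 1) ρ β)).re ∧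
        (∫ U, conj (X (configShift (-(Pi.single 0 (-1))) (gaugeTimeReflect (torusLift (2 * S + 1) U))) -
              ∫ V, X (torusLift (2 * S + 1) V) ∂(wilsonMeasure (d := 4) (L := 2 * S + 1) ρ β)) *
            (X (configShift (-(Pi.single 0 (-1))) (configShift (-(Pi.single 0 (m : ℤ))) (torusLift (2 * S + 1) U))) -
              ∫ V, X (torusLift (2 * S + 1) V) ∂(wilsonMeasure (d := 4) (L := 2 * S + 1) ρ β))
          ∂(wilsonMeasure (d := 4) (L := 2 * S + 1) ρ β)).im = 0) ∧
    (∀ n : ℕ, n ≤ Nn →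
      (∫ U, conj (X (configShift (-(Pi.single 0 (-1))) (gaugeTimeReflect (torusLift (2 * S + 1) U))) -
              ∫ V, X (torusLift (2 * S + 1) V) ∂(wilsonMeasure (d := 4) (L := 2 * S + 1) ρ β)) *
            (X (configShift (-(Pi.single 0 (-1))) (configShift (-(Pi.single 0 ((n + 1 : ℕ) : ℤ))) (torusLift (2 * S + 1) U))) -
              ∫ V, X (torusLift (2 * S + 1) V) ∂(wilsonMeasure (d := 4) (L := 2 * S + 1) ρ β))
          ∂(wilsonMeasure (d := 4) (L := 2 * S + 1) ρ β)).re ≤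
        (∫ U, conj (X (cfgReflect (torusLift (2 * S + 1) U))) * X (torusLift (2 * S + 1) U)
          ∂(wilsonMeasure (d := 4) (L := 2 * S + 1) ρ β)).re * Real.exp (-(M * n / 2)) + ε) ∧
    0 ≤ (∫ U, conj (X (cfgReflect (torusLift (2 * S + 1) U))) * X (torusLift (2 * S + 1) U)
          ∂(wilsonMeasure (d := 4) (L := 2 * S + 1) ρ β)).re := by
  haveI := isProbabilityMeasure_wilsonMeasure (d := 4) (L := 2 * S + 1) ρ hρ β
  set mX : ℂ := ∫ V, X (torusLift (2 * S + 1) V) ∂(wilsonMeasure (d := 4) (L := 2 * S + 1) ρ β) with hmX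
  obtain ⟨CX, hCX⟩ := hXb
  -- the centred observable `X°` and its back-shift `X'`
  set Xc : LGConfig 4 G → ℂ := fun V => X V - mX with hXc
  set X' : LGConfig 4 G → ℂ := fun V => Xc (configShift (-(Pi.single 0 (-1))) V) with hX'
  have hXcm : Measurable Xc := hXm.sub measurable_const
  have hXcb : ∃ C : ℝ, ∀ U, ‖Xc U‖ ≤ C := ⟨CX + ‖mX‖, fun U => (norm_sub_le _ _).trans (add_le_add (hCX U) le_rfl)⟩
  have hXcc : IsCylinder Xc ΛX := fun U V hUV => by
    show X U - mX = X V - mX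
    rw [hX hUV]
  have hX'm : Measurable X' := hXcm.comp (configShift _).measurable
  have hX'b : ∃ C : ℝ, ∀ U, ‖X' U‖ ≤ C := hXcb.imp fun C hC U => hC _
  obtain ⟨Λ', hX'c, hΛ'⟩ := cscl_isCylinder_shift hXcc (-1) hΛX
  have hΛ'' : ∀ e ∈ Λ', 0 ≤ e.1 0 ∧ e.1 0 ≤ (w : ℤ) := fun e he => by have := hΛ' e he; omega
  -- (1) reality / positivity for `m ≤ Nn + 2`
  have hnn : ∀ m : ℕ, m ≤ Nn + 2 →
      0 ≤ (∫ U, conj (X' (gaugeTimeReflect (torusLift (2 * S + 1) U))) *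
        X' (configShift (-(Pi.single 0 (m : ℤ))) (torusLift (2 * S + 1) U)) ∂(wilsonMeasure (d := 4) (L := 2 * S + 1) ρ β)).re ∧
      (∫ U, conj (X' (gaugeTimeReflect (torusLift (2 * S + 1) U))) *
        X' (configShift (-(Pi.single 0 (m : ℤ))) (torusLift (2 * S + 1) U)) ∂(wilsonMeasure (d := 4) (L := 2 * S + 1) ρ β)).im = 0 :=
    fun m hm => cscl_seq_nonneg (S := S) ρ hρ hβ hX'm hX'b hX'c hΛ'' m (by omega)
  -- (2) `P_m(X',X') = P_{m-2}(X°,X°)` (shift identity with `a = -1`, `c = m - 1`)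
  have hP : ∀ m : ℕ,
      (∫ U, conj (X' (gaugeTimeReflect (torusLift (2 * S + 1) U))) *
        X' (configShift (-(Pi.single 0 (m : ℤ))) (torusLift (2 * S + 1) U)) ∂(wilsonMeasure (d := 4) (L := 2 * S + 1) ρ β)) =
      ∫ U, conj (Xc (gaugeTimeReflect (torusLift (2 * S + 1) U))) *
        Xc (configShift (-(Pi.single 0 ((m : ℤ) - 2))) (torusLift (2 * S + 1) U)) ∂(wilsonMeasure (d := 4) (L := 2 * S + 1) ρ β) := by
    intro m
    have h := cscl_shift_pair ρ β (2 * S + 1) Xc Xc (-1) ((m : ℤ) - 1)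
    have hc : (-1 : ℤ) + ((m : ℤ) - 1) = (m : ℤ) - 2 := by ring
    rw [hc] at h
    rw [← h]
    refine integral_congr_ae (Eventually.of_forall fun U => ?_)
    simp only [hX', rpShift_configShift_configShift]
    ring_nf
  -- (3) centring: `P_k(X°,X°) = P_k(X,X) - |mX|²`
  have hcentre : ∀ k : ℤ,
      (∫ U, conj (Xc (gaugeTimeReflect (torusLift (2 * S + 1) U))) *
        Xc (configShift (-(Pi.single 0 k)) (torusLift (2 * S + 1) U)) ∂(wilsonMeasure (d := 4) (L := 2 * S + 1) ρ β)) =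
      (∫ U, conj (X (gaugeTimeReflect (torusLift (2 * S + 1) U))) *
        X (configShift (-(Pi.single 0 k)) (torusLift (2 * S + 1) U)) ∂(wilsonMeasure (d := 4) (L := 2 * S + 1) ρ β)) -
        conj mX * mX :=
    fun k => cscl_centre_identity ρ hρ β (2 * S + 1) hXm hXm ⟨CX, hCX⟩ ⟨CX, hCX⟩ k
  -- (4) the variance `V_X = Re P_{-1}(X,X) ≥ Re P_{-1}(X°,X°) = Re P_1(X',X') ≥ 0`
  have hV : (∫ U, conj (X (cfgReflect (torusLift (2 * S + 1) U))) * X (torusLift (2 * S + 1) U)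
      ∂(wilsonMeasure (d := 4) (L := 2 * S + 1) ρ β)) =
      ∫ U, conj (X (gaugeTimeReflect (torusLift (2 * S + 1) U))) *
        X (configShift (-(Pi.single 0 (-1))) (torusLift (2 * S + 1) U)) ∂(wilsonMeasure (d := 4) (L := 2 * S + 1) ρ β) := by
    have h := cscl_site_pairing_eq ρ β (2 * S + 1) X X 0
    simp only [Pi.single_zero, neg_zero, rpShift_configShift_zero, add_zero] at h
    exact h
  have hmm : (conj mX * mX).re = ‖mX‖ ^ 2 ∧ (conj mX * mX).im = 0 := by
    rw [Complex.conj_mul' mX, ← Complex.ofReal_pow]; exact ⟨Complex.ofReal_re _, Complex.ofReal_im _⟩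
  have hg1 : (∫ U, conj (X' (gaugeTimeReflect (torusLift (2 * S + 1) U))) *
        X' (configShift (-(Pi.single 0 ((1 : ℕ) : ℤ))) (torusLift (2 * S + 1) U)) ∂(wilsonMeasure (d := 4) (L := 2 * S + 1) ρ β)).re =
      (∫ U, conj (X (cfgReflect (torusLift (2 * S + 1) U))) * X (torusLift (2 * S + 1) U)
        ∂(wilsonMeasure (d := 4) (L := 2 * S + 1) ρ β)).re - ‖mX‖ ^ 2 := by
    rw [hP 1, hV, show ((1 : ℕ) : ℤ) - 2 = -1 by norm_num, hcentre (-1), Complex.sub_re, hmm.1]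
  have hVpos : 0 ≤ (∫ U, conj (X (cfgReflect (torusLift (2 * S + 1) U))) * X (torusLift (2 * S + 1) U)
      ∂(wilsonMeasure (d := 4) (L := 2 * S + 1) ρ β)).re := by
    have h := (hnn 1 (by omega)).1
    rw [hg1] at h
    nlinarith [sq_nonneg ‖mX‖]
  -- (5) the chord with slack on `n ↦ Re P_{n+1}(X',X')`, `n ≤ Nn`
  set g : ℕ → ℝ := fun n => (∫ U, conj (X' (gaugeTimeReflect (torusLift (2 * S + 1) U))) *
    X' (configShift (-(Pi.single 0 ((n + 1 : ℕ) : ℤ))) (torusLift (2 * S + 1) U)) ∂(wilsonMeasure (d := 4) (L := 2 * S + 1) ρ β)).re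
    with hg
  have hgpos : ∀ n : ℕ, n ≤ Nn → 0 ≤ g n := fun n hn => (hnn (n + 1) (by omega)).1
  have hglc : ∀ n : ℕ, 1 ≤ n → n + 1 ≤ Nn → g n ^ 2 ≤ g (n - 1) * g (n + 1) := by
    intro n hn1 hn2
    have h := cscl_seq_logConvex (S := S) ρ hρ hβ hX'm hX'b hX'c hΛ'' (n + 1) (by omega) (by omega)
    have e1 : n - 1 + 1 = n + 1 - 1 := by omega
    simp only [hg, e1]
    exact h
  have hgN : g Nn ≤ DX * Real.exp M * Real.exp (-(M * Nn)) := by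
    have h1 : g Nn ≤ ‖(∫ U, conj (X (gaugeTimeReflect (torusLift (2 * S + 1) U))) *
          X (configShift (-(Pi.single 0 ((Nn - 1 : ℕ) : ℤ))) (torusLift (2 * S + 1) U)) ∂(wilsonMeasure (d := 4) (L := 2 * S + 1) ρ β)) -
        conj mX * mX‖ := by
      simp only [hg]
      rw [hP, show ((Nn + 1 : ℕ) : ℤ) - 2 = ((Nn - 1 : ℕ) : ℤ) by push_cast [Nat.cast_sub hNn]; ring, hcentre]
      exact Complex.re_le_norm _
    refine h1.trans ((hcl (Nn - 1) (by omega)).trans ?_)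
    rw [mul_assoc, ← Real.exp_add]
    refine mul_le_mul_of_nonneg_left (Real.exp_le_exp.2 ?_) hDX.le
    rw [Nat.cast_sub hNn]; push_cast; nlinarith
  have hchord := cscl_chord_slack g Nn (DX * Real.exp M) M ε (by omega) hM (by positivity) hε hgpos hglc hgN hthr
  refine ⟨fun m hm => hnn m hm, fun n hn => ?_, hVpos⟩
  have h := hchord n hn
  have hg0 : g 0 ≤ (∫ U, conj (X (cfgReflect (torusLift (2 * S + 1) U))) * X (torusLift (2 * S + 1) U)
      ∂(wilsonMeasure (d := 4) (L := 2 * S + 1) ρ β)).re := by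
    show (∫ U, conj (X' (gaugeTimeReflect (torusLift (2 * S + 1) U))) *
      X' (configShift (-(Pi.single 0 ((0 + 1 : ℕ) : ℤ))) (torusLift (2 * S + 1) U)) ∂(wilsonMeasure (d := 4) (L := 2 * S + 1) ρ β)).re ≤ _
    rw [zero_add, hg1]
    nlinarith [sq_nonneg ‖mX‖]
  have hexp0 : 0 ≤ Real.exp (-(M * n / 2)) := (Real.exp_pos _).le
  calc _ = g n := rfl
    _ ≤ g 0 * Real.exp (-(M * n / 2)) + ε := h
    _ ≤ _ := by nlinarith [mul_le_mul_of_nonneg_right hg0 hexp0]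

end Torus

/-- **Registered anchor of this file** (closed form of `cscl_sqrt_slack`, for the gate's `--supports` stub check).
[folklore] -/
theorem cscl_anchor_slack :
    ∀ (a b ε : ℝ), 0 ≤ a → 0 ≤ b → 0 ≤ ε →
      Real.sqrt ((a + ε) * (b + ε)) ≤ Real.sqrt a * Real.sqrt b + Real.sqrt ε * (Real.sqrt a + Real.sqrt b) + ε :=
  fun _ _ _ ha hb hε => cscl_sqrt_slack ha hb hε

end Summit.QuantumFields.YangMills.Theorems.ContinuumLegGivenGap

end


-- ═════════════════════════════════════════════════════════════════════════════════════════════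
-- FILE: Summits/QuantumFields/YangMills/Theorems/ConvexGribovBodyContinuumLegGivenGapCsclTorusPair.lean
-- (imports of the standalone file: see Lines/Sketch17CS-LANDING.md)
-- ═════════════════════════════════════════════════════════════════════════════════════════════

/-!
# `ContinuumLegGivenGap` (stmt-QuantumFields-15828), line `Sketch`, reshape 17-CS, helper 4 of `stub_csclOfLock`:
# Cauchy–Schwarz clustering with OS-norm constants on ONE odd torus, from per-observable clustering + positivity

Sequel of `…CsclChordSlack`. `cscl_torus_pair` — THE PER-TORUS STATEMENT of reshape 17-CS: on the torus of side `2S+1`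
(`β ≥ 0`), for bounded measurable complex cylinder observables `X, Y` of the `ℤ⁴` gauge field supported at lattice times
in `[1, w]`, if the reflected connected time correlation of `X` with itself (resp. `Y` with itself) is `≤ D_X e^{−Mn}`
(resp. `≤ D_Y e^{−Mn}`) for all `n ≤ S` — per-observable constants, as the crux's locked lattice gap gives them — and the
torus is long (`2w + N + 10 ≤ S`, `D e^{M} ≤ ε e^{MN/2}`), then for every shift `0 ≤ s ≤ N`
`‖∫ conj X(cfgReflect Ũ) Y(τˢŨ) dμ − conj ⟨X⟩⟨Y⟩‖ ≤ e^{−Ms/2} √V_X √V_Y + √ε (√V_X + √V_Y) + ε`,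
`V_X = Re ∫ conj X(cfgReflect Ũ) X(Ũ)`: OS-NORM constants at half rate; the per-observable constants only enter the length
condition. Proof: the pairing is `P_{s+1}(X',Y')` for the centred back-shifted observables; by parity it is a bond- or
site-form value of `(X'τᵃ, Y'τᵃ)`; Cauchy–Schwarz there, then `cscl_obs_chord` for `X` and for `Y`, then `cscl_sqrt_slack`.
Registered anchor: `cscl_anchor_pair`. Refs: Osterwalder–Seiler 1978 §2; Glimm–Jaffe 1987 §6.1. No definitions.
-/

noncomputable section

open scoped ComplexConjugate
open MeasureTheory Filter
open Literature.MathematicalPhysics.QuantumFieldTheory Literature.MathematicalPhysics.QuantumLattice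
open Summit.QuantumFields.YangMills.Theorems.ClusteringToYangMills.Reconstructible
open Summit.QuantumFields.YangMills.Theorems.CriticalContinuumLimit.AdmissibleGap (maxTime)

namespace Summit.QuantumFields.YangMills.Theorems.ContinuumLegGivenGap

section Torus

variable {G : Type} [Group G] [TopologicalSpace G] [IsTopologicalGroup G] [CompactSpace G]
  [MeasurableSpace G] [BorelSpace G] {N : ℕ} (ρ : G →* Matrix (Fin N) (Fin N) ℂ)

/-- **Cauchy–Schwarz clustering with OS norms on one odd torus** (see the module docstring). [folklore] -/
theorem cscl_torus_pair (hρ : Continuous ρ) {β : ℝ} (hβ : 0 ≤ β) {S w Nn : ℕ} {X Y : LGConfig 4 G → ℂ}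
    (hXm : Measurable X) (hYm : Measurable Y) (hXb : ∃ C : ℝ, ∀ U, ‖X U‖ ≤ C) (hYb : ∃ C : ℝ, ∀ U, ‖Y U‖ ≤ C)
    {ΛX ΛY : Finset (Literature.MathematicalPhysics.QuantumLattice.ZdEdge 4)} (hX : IsCylinder X ΛX) (hY : IsCylinder Y ΛY)
    (hΛX : ∀ e ∈ ΛX, 1 ≤ e.1 0 ∧ e.1 0 ≤ (w : ℤ)) (hΛY : ∀ e ∈ ΛY, 1 ≤ e.1 0 ∧ e.1 0 ≤ (w : ℤ))
    {M ε DX DY : ℝ} (hM : 0 ≤ M) (hε : 0 < ε) (hDX : 0 < DX) (hDY : 0 < DY) (hNn : 1 ≤ Nn) (hwin : 2 * w + Nn + 10 ≤ S)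
    (hclX : ∀ n : ℕ, n ≤ S →
      ‖(∫ U, conj (X (gaugeTimeReflect (torusLift (2 * S + 1) U))) *
          X (configShift (-(Pi.single 0 (n : ℤ))) (torusLift (2 * S + 1) U)) ∂(wilsonMeasure (d := 4) (L := 2 * S + 1) ρ β)) -
        conj (∫ V, X (torusLift (2 * S + 1) V) ∂(wilsonMeasure (d := 4) (L := 2 * S + 1) ρ β)) *
          ∫ V, X (torusLift (2 * S + 1) V) ∂(wilsonMeasure (d := 4) (L := 2 * S + 1) ρ β)‖ ≤ DX * Real.exp (-(M * n)))
    (hclY : ∀ n : ℕ, n ≤ S →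
      ‖(∫ U, conj (Y (gaugeTimeReflect (torusLift (2 * S + 1) U))) *
          Y (configShift (-(Pi.single 0 (n : ℤ))) (torusLift (2 * S + 1) U)) ∂(wilsonMeasure (d := 4) (L := 2 * S + 1) ρ β)) -
        conj (∫ V, Y (torusLift (2 * S + 1) V) ∂(wilsonMeasure (d := 4) (L := 2 * S + 1) ρ β)) *
          ∫ V, Y (torusLift (2 * S + 1) V) ∂(wilsonMeasure (d := 4) (L := 2 * S + 1) ρ β)‖ ≤ DY * Real.exp (-(M * n)))
    (hthrX : DX * Real.exp M ≤ ε * Real.exp (M * Nn / 2)) (hthrY : DY * Real.exp M ≤ ε * Real.exp (M * Nn / 2)) :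
    ∀ s : ℕ, s ≤ Nn →
      ‖(∫ U, conj (X (cfgReflect (torusLift (2 * S + 1) U))) *
            Y (configShift (-(Pi.single 0 (s : ℤ))) (torusLift (2 * S + 1) U)) ∂(wilsonMeasure (d := 4) (L := 2 * S + 1) ρ β)) -
          conj (∫ V, X (torusLift (2 * S + 1) V) ∂(wilsonMeasure (d := 4) (L := 2 * S + 1) ρ β)) *
            ∫ V, Y (torusLift (2 * S + 1) V) ∂(wilsonMeasure (d := 4) (L := 2 * S + 1) ρ β)‖ ≤
        Real.exp (-(M * s / 2)) *
            Real.sqrt (∫ U, conj (X (cfgReflect (torusLift (2 * S + 1) U))) * X (torusLift (2 * S + 1) U)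
              ∂(wilsonMeasure (d := 4) (L := 2 * S + 1) ρ β)).re *
            Real.sqrt (∫ U, conj (Y (cfgReflect (torusLift (2 * S + 1) U))) * Y (torusLift (2 * S + 1) U)
              ∂(wilsonMeasure (d := 4) (L := 2 * S + 1) ρ β)).re +
          Real.sqrt ε *
            (Real.sqrt (∫ U, conj (X (cfgReflect (torusLift (2 * S + 1) U))) * X (torusLift (2 * S + 1) U)
                ∂(wilsonMeasure (d := 4) (L := 2 * S + 1) ρ β)).re +
              Real.sqrt (∫ U, conj (Y (cfgReflect (torusLift (2 * S + 1) U))) * Y (torusLift (2 * S + 1) U)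
                ∂(wilsonMeasure (d := 4) (L := 2 * S + 1) ρ β)).re) + ε := by
  haveI := isProbabilityMeasure_wilsonMeasure (d := 4) (L := 2 * S + 1) ρ hρ β
  have hS1 : 1 ≤ S := by omega
  intro s hs
  set μW := wilsonMeasure (d := 4) (L := 2 * S + 1) ρ β with hμW
  set mX : ℂ := ∫ V, X (torusLift (2 * S + 1) V) ∂μW with hmX
  set mY : ℂ := ∫ V, Y (torusLift (2 * S + 1) V) ∂μW with hmY
  set VX : ℝ := (∫ U, conj (X (cfgReflect (torusLift (2 * S + 1) U))) * X (torusLift (2 * S + 1) U) ∂μW).re with hVX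
  set VY : ℝ := (∫ U, conj (Y (cfgReflect (torusLift (2 * S + 1) U))) * Y (torusLift (2 * S + 1) U) ∂μW).re with hVY
  obtain ⟨CX, hCX⟩ := hXb
  obtain ⟨CY, hCY⟩ := hYb
  -- centred, back-shifted observables
  set Xc : LGConfig 4 G → ℂ := fun V => X V - mX with hXc
  set Yc : LGConfig 4 G → ℂ := fun V => Y V - mY with hYc
  set X' : LGConfig 4 G → ℂ := fun V => Xc (configShift (-(Pi.single 0 (-1))) V) with hX'
  set Y' : LGConfig 4 G → ℂ := fun V => Yc (configShift (-(Pi.single 0 (-1))) V) with hY'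
  have hXcm : Measurable Xc := hXm.sub measurable_const
  have hYcm : Measurable Yc := hYm.sub measurable_const
  have hXcb : ∃ C : ℝ, ∀ U, ‖Xc U‖ ≤ C := ⟨CX + ‖mX‖, fun U => (norm_sub_le _ _).trans (add_le_add (hCX U) le_rfl)⟩
  have hYcb : ∃ C : ℝ, ∀ U, ‖Yc U‖ ≤ C := ⟨CY + ‖mY‖, fun U => (norm_sub_le _ _).trans (add_le_add (hCY U) le_rfl)⟩
  have hXcc : IsCylinder Xc ΛX := fun U V hUV => by show X U - mX = X V - mX; rw [hX hUV]
  have hYcc : IsCylinder Yc ΛY := fun U V hUV => by show Y U - mY = Y V - mY; rw [hY hUV]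
  obtain ⟨ΛX', hX'c, hΛX'⟩ := cscl_isCylinder_shift hXcc (-1) hΛX
  obtain ⟨ΛY', hY'c, hΛY'⟩ := cscl_isCylinder_shift hYcc (-1) hΛY
  have hΛX'' : ∀ e ∈ ΛX', 0 ≤ e.1 0 ∧ e.1 0 ≤ (w : ℤ) := fun e he => by have := hΛX' e he; omega
  have hΛY'' : ∀ e ∈ ΛY', 0 ≤ e.1 0 ∧ e.1 0 ≤ (w : ℤ) := fun e he => by have := hΛY' e he; omega
  have hX'm : Measurable X' := hXcm.comp (configShift _).measurable
  have hY'm : Measurable Y' := hYcm.comp (configShift _).measurable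
  have hX'b : ∃ C : ℝ, ∀ U, ‖X' U‖ ≤ C := hXcb.imp fun C hC U => hC _
  have hY'b : ∃ C : ℝ, ∀ U, ‖Y' U‖ ≤ C := hYcb.imp fun C hC U => hC _
  -- the chords for `X` and for `Y`
  obtain ⟨hnnX, hchX, hVX0⟩ := cscl_obs_chord ρ hρ hβ hXm ⟨CX, hCX⟩ hX hΛX hM hε hDX hNn hwin hclX hthrX
  obtain ⟨hnnY, hchY, hVY0⟩ := cscl_obs_chord ρ hρ hβ hYm ⟨CY, hCY⟩ hY hΛY hM hε hDY hNn hwin hclY hthrY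
  -- the target pairing is `P_{s+1}(X',Y')`
  have htarget : (∫ U, conj (X (cfgReflect (torusLift (2 * S + 1) U))) *
        Y (configShift (-(Pi.single 0 (s : ℤ))) (torusLift (2 * S + 1) U)) ∂μW) - conj mX * mY =
      ∫ U, conj (X' (gaugeTimeReflect (torusLift (2 * S + 1) U))) *
        Y' (configShift (-(Pi.single 0 ((s : ℤ) + 1))) (torusLift (2 * S + 1) U)) ∂μW := by
    rw [cscl_site_pairing_eq ρ β (2 * S + 1) X Y s, ← cscl_centre_identity ρ hρ β (2 * S + 1) hXm hYm ⟨CX, hCX⟩ ⟨CY, hCY⟩]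
    have h := cscl_shift_pair ρ β (2 * S + 1) Xc Yc (-1) (s : ℤ)
    rw [← h]
    refine integral_congr_ae (Eventually.of_forall fun U => ?_)
    simp only [hX', hY', rpShift_configShift_configShift]
    ring_nf
  rw [htarget]
  -- Cauchy–Schwarz in the form of the right parity
  have hcs : ‖∫ U, conj (X' (gaugeTimeReflect (torusLift (2 * S + 1) U))) *
        Y' (configShift (-(Pi.single 0 ((s : ℤ) + 1))) (torusLift (2 * S + 1) U)) ∂μW‖ ^ 2 ≤
      (∫ U, conj (X' (gaugeTimeReflect (torusLift (2 * S + 1) U))) *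
          X' (configShift (-(Pi.single 0 ((s + 1 : ℕ) : ℤ))) (torusLift (2 * S + 1) U)) ∂μW).re *
      (∫ U, conj (Y' (gaugeTimeReflect (torusLift (2 * S + 1) U))) *
          Y' (configShift (-(Pi.single 0 ((s + 1 : ℕ) : ℤ))) (torusLift (2 * S + 1) U)) ∂μW).re := by
    have hshm : ∀ (Z : LGConfig 4 G → ℂ), Measurable Z → ∀ b : ℤ,
        Measurable fun V => Z (configShift (-(Pi.single 0 b)) V) := fun Z hZ b => hZ.comp (configShift _).measurable
    have hshb : ∀ (Z : LGConfig 4 G → ℂ), (∃ C : ℝ, ∀ U, ‖Z U‖ ≤ C) → ∀ b : ℤ,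
        ∃ C : ℝ, ∀ U, ‖Z (configShift (-(Pi.single 0 b)) U)‖ ≤ C := fun Z hZ b => hZ.imp fun C hC U => hC _
    obtain ⟨a, ha⟩ := Nat.even_or_odd' (s + 1)
    obtain ⟨Λ1, hA1, hΛ1⟩ := cscl_isCylinder_shift hX'c (a : ℤ) hΛX''
    obtain ⟨Λ2, hA2, hΛ2⟩ := cscl_isCylinder_shift hY'c (a : ℤ) hΛY''
    obtain ⟨hpos1, hmax1⟩ := cscl_timeSupp_finset hΛ1 (by omega)
    obtain ⟨hpos2, hmax2⟩ := cscl_timeSupp_finset hΛ2 (by omega)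
    rcases ha with h2 | h2
    · -- `s + 1 = 2a`: bond form of `(X'τᵃ, Y'τᵃ)`
      have hS1' : maxTime Λ1 + 1 ≤ S := by
        have : (maxTime Λ1 : ℤ) ≤ max ((w : ℤ) + a) 0 := hmax1
        omega
      have hS2' : maxTime Λ2 + 1 ≤ S := by
        have : (maxTime Λ2 : ℤ) ≤ max ((w : ℤ) + a) 0 := hmax2
        omega
      obtain ⟨hc, -, -⟩ := cscl_bond_cs ρ hρ hβ hS1 (hshm X' hX'm a) (hshm Y' hY'm a) (hshb X' hX'b a)
        (hshb Y' hY'b a) hA1 hA2 hpos1 hpos2 hS1' hS2'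
      have e12 := cscl_shift_pair ρ β (2 * S + 1) X' Y' (a : ℤ) (a : ℤ)
      have e11 := cscl_shift_pair ρ β (2 * S + 1) X' X' (a : ℤ) (a : ℤ)
      have e22 := cscl_shift_pair ρ β (2 * S + 1) Y' Y' (a : ℤ) (a : ℤ)
      have c1 : ((a : ℤ) + a) = (s : ℤ) + 1 := by omega
      have c2 : ((a : ℤ) + a) = ((s + 1 : ℕ) : ℤ) := by omega
      rw [c1] at e12; rw [c2] at e11 e22
      rw [e12, e11, e22] at hc
      exact hc
    · -- `s + 1 = 2a + 1`: site form of `(X'τᵃ, Y'τᵃ)`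
      have hS1' : maxTime Λ1 + 2 ≤ S := by
        have : (maxTime Λ1 : ℤ) ≤ max ((w : ℤ) + a) 0 := hmax1
        omega
      have hS2' : maxTime Λ2 + 2 ≤ S := by
        have : (maxTime Λ2 : ℤ) ≤ max ((w : ℤ) + a) 0 := hmax2
        omega
      obtain ⟨hc, -, -⟩ := cscl_site_cs ρ hρ hβ (hshm X' hX'm a) (hshm Y' hY'm a) (hshb X' hX'b a)
        (hshb Y' hY'b a) hA1 hA2 hpos1 hpos2 hS1' hS2'
      have e12 := cscl_shift_pair ρ β (2 * S + 1) X' Y' (a : ℤ) ((a : ℤ) + 1)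
      have e11 := cscl_shift_pair ρ β (2 * S + 1) X' X' (a : ℤ) ((a : ℤ) + 1)
      have e22 := cscl_shift_pair ρ β (2 * S + 1) Y' Y' (a : ℤ) ((a : ℤ) + 1)
      have hτ : ∀ (W : LGConfig 4 G), configShift (-(Pi.single 0 ((a : ℤ) + 1))) W =
          configShift (-(Pi.single 0 (a : ℤ))) (gaugeTimeShift W) := fun W =>
        (rpShift_configShift_gaugeTimeShift (a : ℤ) W).symm
      simp only [hτ] at e12 e11 e22
      have c1 : ((a : ℤ) + (a + 1)) = (s : ℤ) + 1 := by omega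
      have c2 : ((a : ℤ) + (a + 1)) = ((s + 1 : ℕ) : ℤ) := by omega
      rw [c1] at e12; rw [c2] at e11 e22
      rw [e12, e11, e22] at hc
      exact hc
  -- the two chords, then the slack algebra
  have hgX := hchX s hs
  have hgY := hchY s hs
  have hexp0 : 0 < Real.exp (-(M * s / 2)) := Real.exp_pos _
  set aX : ℝ := VX * Real.exp (-(M * s / 2)) with haX
  set aY : ℝ := VY * Real.exp (-(M * s / 2)) with haY
  have haX0 : 0 ≤ aX := mul_nonneg hVX0 hexp0.le
  have haY0 : 0 ≤ aY := mul_nonneg hVY0 hexp0.le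
  have hsq : ‖∫ U, conj (X' (gaugeTimeReflect (torusLift (2 * S + 1) U))) *
      Y' (configShift (-(Pi.single 0 ((s : ℤ) + 1))) (torusLift (2 * S + 1) U)) ∂μW‖ ^ 2 ≤ (aX + ε) * (aY + ε) := by
    refine hcs.trans ?_
    have h1 := (hnnY (s + 1) (by omega)).1
    exact mul_le_mul hgX hgY h1 (by linarith)
  have hnorm : ‖∫ U, conj (X' (gaugeTimeReflect (torusLift (2 * S + 1) U))) *
      Y' (configShift (-(Pi.single 0 ((s : ℤ) + 1))) (torusLift (2 * S + 1) U)) ∂μW‖ ≤ Real.sqrt ((aX + ε) * (aY + ε)) := by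
    rw [← Real.sqrt_sq (norm_nonneg _)]
    exact Real.sqrt_le_sqrt hsq
  refine hnorm.trans ((cscl_sqrt_slack haX0 haY0 hε.le).trans ?_)
  -- `√aX √aY = e^{-Ms/2} √VX √VY`, `√aX ≤ √VX`, `√aY ≤ √VY`
  have hsaX : Real.sqrt aX = Real.sqrt VX * Real.sqrt (Real.exp (-(M * s / 2))) := Real.sqrt_mul hVX0 _
  have hsaY : Real.sqrt aY = Real.sqrt VY * Real.sqrt (Real.exp (-(M * s / 2))) := Real.sqrt_mul hVY0 _
  have hee : Real.sqrt (Real.exp (-(M * s / 2))) * Real.sqrt (Real.exp (-(M * s / 2))) = Real.exp (-(M * s / 2)) :=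
    Real.mul_self_sqrt hexp0.le
  have he1 : Real.sqrt (Real.exp (-(M * s / 2))) ≤ 1 := by
    rw [Real.sqrt_le_one]
    have : 0 ≤ M * s / 2 := by positivity
    exact Real.exp_le_one_iff.2 (by linarith)
  have hprod : Real.sqrt aX * Real.sqrt aY = Real.exp (-(M * s / 2)) * Real.sqrt VX * Real.sqrt VY := by
    rw [hsaX, hsaY, show Real.sqrt VX * Real.sqrt (Real.exp (-(M * s / 2))) *
        (Real.sqrt VY * Real.sqrt (Real.exp (-(M * s / 2)))) =
      (Real.sqrt (Real.exp (-(M * s / 2))) * Real.sqrt (Real.exp (-(M * s / 2)))) * Real.sqrt VX * Real.sqrt VY by ring,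
      hee]
  have hle1 : Real.sqrt aX ≤ Real.sqrt VX := by
    rw [hsaX]; exact mul_le_of_le_one_right (Real.sqrt_nonneg _) he1
  have hle2 : Real.sqrt aY ≤ Real.sqrt VY := by
    rw [hsaY]; exact mul_le_of_le_one_right (Real.sqrt_nonneg _) he1
  have hsε := Real.sqrt_nonneg ε
  have hfin := mul_le_mul_of_nonneg_left (add_le_add hle1 hle2) hsε
  linarith [hprod, hfin]

end Torus

/-- **Registered anchor of this file** (a closed elementary consequence, for the gate's `--supports` stub check):
`√(V e^{−t}) ≤ √V` for `V ≥ 0`, `t ≥ 0`. [folklore] -/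
theorem cscl_anchor_pair :
    ∀ (V t : ℝ), 0 ≤ V → 0 ≤ t → Real.sqrt (V * Real.exp (-t)) ≤ Real.sqrt V := by
  intro V t hV ht
  rw [Real.sqrt_mul hV]
  refine mul_le_of_le_one_right (Real.sqrt_nonneg _) ?_
  rw [Real.sqrt_le_one]
  exact Real.exp_le_one_iff.2 (by linarith)

end Summit.QuantumFields.YangMills.Theorems.ContinuumLegGivenGap

end


-- ═════════════════════════════════════════════════════════════════════════════════════════════
-- FILE: Summits/QuantumFields/YangMills/Theorems/ConvexGribovBodyContinuumLegGivenGapCsclObs.lean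
-- (imports of the standalone file: see Lines/Sketch17CS-LANDING.md)
-- ═════════════════════════════════════════════════════════════════════════════════════════════

/-!
# `ContinuumLegGivenGap` (stmt-QuantumFields-15828), line `Sketch`, reshape 17-CS, helper 5 of `stub_csclOfLock`:
# lattice representatives as local gauge-invariant observables with prescribed supports; the complex
# self-correlation is a sum of four real connected correlations

For a species `P : YMSpecies G`, real weights `wt` on a finite set `B` of `n`-tuples of sites and a centring constant
`m̄`, the function `V ↦ ∑_{x ∈ B} wt x ∏ᵢ (P(τ_{xᵢ}V) − m̄)` is gauge invariant, measurable, bounded, and a cylinder on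
any edge set `Λ` containing the translated supports of the tuples with non-zero weight (`cscl_rep_*`); hence it is
the underlying function of a `YMSpecies` with support EXACTLY `Λ` (`cscl_rep_species`), and so is its bond reflection
with the reflected support (`cscl_rep_species_reflect`, via the landed `obsGeometry_species_reflect`). For a complex
observable written as `Z = Z₁ + i Z₂` with real bounded measurable parts, the reflected connected self-correlation
`∫ conj Z(ΘŨ) Z(τⁿŨ) − |⟨Z⟩|²` is the signed sum of the four real connected correlations
`latticeConnectedCorr ρ β (2S+1) (Zᵢ ∘ Θ) Zⱼ n` (`cscl_selfCorr_eq`), hence bounded by the sum of their moduli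
(`cscl_selfCorr_le`). Registered anchor: `cscl_anchor_obs`. No definitions. [folklore]
-/

noncomputable section

open scoped ComplexConjugate
open MeasureTheory Filter
open Literature.MathematicalPhysics.QuantumFieldTheory Literature.MathematicalPhysics.QuantumLattice
open Summit.QuantumFields.YangMills.Theorems.ClusteringToYangMills.Reconstructible

namespace Summit.QuantumFields.YangMills.Theorems.ContinuumLegGivenGap

section Rep

variable {G : Type} [Group G] [MeasurableSpace G]

/-- Gauge invariance of the weighted sum of products of translated species values. [folklore] -/
theorem cscl_rep_gaugeInvariant (P : YMSpecies G) {n : ℕ} (B : Finset (Fin n → Literature.Probability.LatticeModels.Site 4))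
    (wt : (Fin n → Literature.Probability.LatticeModels.Site 4) → ℝ) (mb : ℝ) :
    IsZdGaugeInvariant fun V : LGConfig 4 G => ∑ x ∈ B, wt x * ∏ i, (P.F (configShift (-(x i)) V) - mb) := by
  intro g U
  refine Finset.sum_congr rfl fun x _ => ?_
  congr 1
  refine Finset.prod_congr rfl fun i _ => ?_
  have h := obsGeometry_isZdGaugeInvariant_comp_configShift P.gaugeInvariant (-(x i)) g U
  simp only [Function.comp_apply] at h
  rw [h]

/-- Measurability of the weighted sum of products. [folklore] -/
theorem cscl_rep_measurable (P : YMSpecies G) {n : ℕ} (B : Finset (Fin n → Literature.Probability.LatticeModels.Site 4))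
    (wt : (Fin n → Literature.Probability.LatticeModels.Site 4) → ℝ) (mb : ℝ) :
    Measurable fun V : LGConfig 4 G => ∑ x ∈ B, wt x * ∏ i, (P.F (configShift (-(x i)) V) - mb) := by
  refine Finset.measurable_sum _ fun x _ => (Finset.measurable_prod _ fun i _ => ?_).const_mul _
  exact (P.measurable.comp (configShift _).measurable).sub_const _

/-- Boundedness of the weighted sum of products: `≤ ∑ |wt x| (C_P + |m̄|)ⁿ`. [folklore] -/
theorem cscl_rep_bounded (P : YMSpecies G) {n : ℕ} (B : Finset (Fin n → Literature.Probability.LatticeModels.Site 4))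
    (wt : (Fin n → Literature.Probability.LatticeModels.Site 4) → ℝ) (mb : ℝ) {CP : ℝ} (hCP : ∀ U, |P.F U| ≤ CP) :
    ∀ V : LGConfig 4 G, |∑ x ∈ B, wt x * ∏ i, (P.F (configShift (-(x i)) V) - mb)| ≤
      (∑ x ∈ B, |wt x|) * (CP + |mb|) ^ n := by
  intro V
  rw [Finset.sum_mul]
  refine (Finset.abs_sum_le_sum_abs _ _).trans (Finset.sum_le_sum fun x _ => ?_)
  rw [abs_mul, Finset.abs_prod]
  refine mul_le_mul_of_nonneg_left ?_ (abs_nonneg _)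
  calc ∏ i, |P.F (configShift (-(x i)) V) - mb| ≤ ∏ _i : Fin n, (CP + |mb|) :=
        Finset.prod_le_prod (fun i _ => abs_nonneg _) fun i _ => (abs_sub _ _).trans (add_le_add (hCP _) le_rfl)
    _ = (CP + |mb|) ^ n := by simp

/-- **Cylinder property**: if `Λ` contains the translated support `P.supp + xᵢ` of every tuple `x ∈ B` of non-zero
weight, the weighted sum of products is a cylinder on `Λ`. [folklore] -/
theorem cscl_rep_isCylinder (P : YMSpecies G) {n : ℕ} (B : Finset (Fin n → Literature.Probability.LatticeModels.Site 4))
    (wt : (Fin n → Literature.Probability.LatticeModels.Site 4) → ℝ) (mb : ℝ)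
    {Λ : Finset (Literature.MathematicalPhysics.QuantumLattice.ZdEdge 4)}
    (hΛ : ∀ x ∈ B, wt x ≠ 0 → ∀ i, ∀ e ∈ P.supp, (e.1 + x i, e.2) ∈ Λ) :
    IsCylinder (fun V : LGConfig 4 G => ∑ x ∈ B, wt x * ∏ i, (P.F (configShift (-(x i)) V) - mb)) Λ := by
  intro U V hUV
  refine Finset.sum_congr rfl fun x hx => ?_
  by_cases hw : wt x = 0
  · simp [hw]
  congr 1
  refine Finset.prod_congr rfl fun i _ => ?_
  congr 1
  refine P.isCylinder fun e he => ?_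
  simp only [Literature.MathematicalPhysics.QuantumLattice.configShift_apply]
  have h1 : e.1 - -(x i) = e.1 + x i := by funext j; simp
  rw [h1]
  exact hUV _ (Finset.mem_coe.2 (hΛ x hx hw i e (Finset.mem_coe.1 he)))

/-- **Packaging as a species with prescribed support.** [folklore] -/
theorem cscl_rep_species (P : YMSpecies G) {n : ℕ} (B : Finset (Fin n → Literature.Probability.LatticeModels.Site 4))
    (wt : (Fin n → Literature.Probability.LatticeModels.Site 4) → ℝ) (mb : ℝ)
    {Λ : Finset (Literature.MathematicalPhysics.QuantumLattice.ZdEdge 4)}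
    (hΛ : ∀ x ∈ B, wt x ≠ 0 → ∀ i, ∀ e ∈ P.supp, (e.1 + x i, e.2) ∈ Λ) :
    ∃ O : YMSpecies G, (O.F = fun V => ∑ x ∈ B, wt x * ∏ i, (P.F (configShift (-(x i)) V) - mb)) ∧ O.supp = Λ := by
  obtain ⟨CP, hCP⟩ := P.bounded
  exact ⟨⟨fun V => ∑ x ∈ B, wt x * ∏ i, (P.F (configShift (-(x i)) V) - mb), Λ,
    cscl_rep_isCylinder P B wt mb hΛ, cscl_rep_gaugeInvariant P B wt mb,
    ⟨_, cscl_rep_bounded P B wt mb hCP⟩, cscl_rep_measurable P B wt mb⟩, rfl, rfl⟩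

/-- **The bond reflection of the representative as a species with the reflected support.** [folklore] -/
theorem cscl_rep_species_reflect [MeasurableInv G] (P : YMSpecies G) {n : ℕ}
    (B : Finset (Fin n → Literature.Probability.LatticeModels.Site 4))
    (wt : (Fin n → Literature.Probability.LatticeModels.Site 4) → ℝ) (mb : ℝ)
    {Λ : Finset (Literature.MathematicalPhysics.QuantumLattice.ZdEdge 4)}
    (hΛ : ∀ x ∈ B, wt x ≠ 0 → ∀ i, ∀ e ∈ P.supp, (e.1 + x i, e.2) ∈ Λ) :
    ∃ O : YMSpecies G, (O.F = fun V => ∑ x ∈ B, wt x * ∏ i, (P.F (configShift (-(x i)) (gaugeTimeReflect V)) - mb)) ∧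
      O.supp = Λ.image (fun e => if e.2 = 0 then (latticeTimeReflection 4 (e.1 + Pi.single 0 1), 0)
        else (latticeTimeReflection 4 e.1, e.2)) := by
  obtain ⟨O, hOF, hOs⟩ := cscl_rep_species P B wt mb hΛ
  obtain ⟨O', hO'F, hO's⟩ := obsGeometry_species_reflect O
  refine ⟨O', ?_, by rw [hO's, hOs]⟩
  rw [hO'F, hOF]
  rfl

end Rep

/-! ### The complex self-correlation as four real connected correlations -/

section Corr

variable {G : Type} [Group G] [TopologicalSpace G] [IsTopologicalGroup G] [CompactSpace G]
  [MeasurableSpace G] [BorelSpace G] {N : ℕ} (ρ : G →* Matrix (Fin N) (Fin N) ℂ)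

/-- **`∫ conj Z(ΘŨ) Z(τⁿŨ) − |⟨Z⟩|²` for `Z = Z₁ + iZ₂`** is
`corr(Z₁∘Θ, Z₁; n) + corr(Z₂∘Θ, Z₂; n) + i (corr(Z₁∘Θ, Z₂; n) − corr(Z₂∘Θ, Z₁; n))`
with `corr = latticeConnectedCorr ρ β (2S+1)` (reflection invariance for the means of the reflected parts). [folklore] -/
theorem cscl_selfCorr_eq (hρ : Continuous ρ) (β : ℝ) (S : ℕ) {Z₁ Z₂ : LGConfig 4 G → ℝ}
    (h1m : Measurable Z₁) (h2m : Measurable Z₂) (h1b : ∃ C : ℝ, ∀ U, |Z₁ U| ≤ C) (h2b : ∃ C : ℝ, ∀ U, |Z₂ U| ≤ C)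
    (n : ℕ) :
    (∫ U, conj ((Z₁ (gaugeTimeReflect (torusLift (2 * S + 1) U)) : ℂ) + Complex.I * (Z₂ (gaugeTimeReflect (torusLift (2 * S + 1) U)) : ℂ)) * ((Z₁ (configShift (-(Pi.single 0 (n : ℤ))) (torusLift (2 * S + 1) U)) : ℂ) + Complex.I * (Z₂ (configShift (-(Pi.single 0 (n : ℤ))) (torusLift (2 * S + 1) U)) : ℂ)) ∂(wilsonMeasure (d := 4) (L := 2 * S + 1) ρ β)) -
      conj (∫ V, ((Z₁ (torusLift (2 * S + 1) V) : ℂ) + Complex.I * (Z₂ (torusLift (2 * S + 1) V) : ℂ)) ∂(wilsonMeasure (d := 4) (L := 2 * S + 1) ρ β)) * (∫ V, ((Z₁ (torusLift (2 * S + 1) V) : ℂ) + Complex.I * (Z₂ (torusLift (2 * S + 1) V) : ℂ)) ∂(wilsonMeasure (d := 4) (L := 2 * S + 1) ρ β)) =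
      ((latticeConnectedCorr ρ β (2 * S + 1) (Z₁ ∘ gaugeTimeReflect) Z₁ n +
          latticeConnectedCorr ρ β (2 * S + 1) (Z₂ ∘ gaugeTimeReflect) Z₂ n : ℝ) : ℂ) +
        Complex.I * ((latticeConnectedCorr ρ β (2 * S + 1) (Z₁ ∘ gaugeTimeReflect) Z₂ n -
          latticeConnectedCorr ρ β (2 * S + 1) (Z₂ ∘ gaugeTimeReflect) Z₁ n : ℝ) : ℂ) := by
  haveI := isProbabilityMeasure_wilsonMeasure (d := 4) (L := 2 * S + 1) ρ hρ β
  obtain ⟨C1, hC1⟩ := h1b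
  obtain ⟨C2, hC2⟩ := h2b
  -- real integrability facts
  have hint : ∀ {f : GaugeConfig 4 (2 * S + 1) G → ℝ}, Measurable f → (∃ C : ℝ, ∀ U, |f U| ≤ C) → Integrable f (wilsonMeasure (d := 4) (L := 2 * S + 1) ρ β) := by
    intro f hf hb
    obtain ⟨C, hC⟩ := hb
    exact Integrable.of_bound hf.aestronglyMeasurable C (Eventually.of_forall fun U => by
      rw [Real.norm_eq_abs]; exact hC U)
  have mR : ∀ {Z : LGConfig 4 G → ℝ}, Measurable Z → Measurable fun U : GaugeConfig 4 (2 * S + 1) G =>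
      Z (gaugeTimeReflect (torusLift (2 * S + 1) U)) := fun hZ =>
    hZ.comp (measurable_gaugeTimeReflect.comp (measurable_torusLift _))
  have mT : ∀ {Z : LGConfig 4 G → ℝ}, Measurable Z → Measurable fun U : GaugeConfig 4 (2 * S + 1) G =>
      Z (configShift (-(Pi.single 0 (n : ℤ))) (torusLift (2 * S + 1) U)) := fun hZ =>
    hZ.comp ((configShift _).measurable.comp (measurable_torusLift _))
  have mL : ∀ {Z : LGConfig 4 G → ℝ}, Measurable Z → Measurable fun U : GaugeConfig 4 (2 * S + 1) G =>
      Z (torusLift (2 * S + 1) U) := fun hZ => hZ.comp (measurable_torusLift _)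
  -- means and reflected means
  -- expand everything into real integrals
  have hI : ∀ (A B : LGConfig 4 G → ℝ), Measurable A → Measurable B → (∃ C : ℝ, ∀ U, |A U| ≤ C) →
      (∃ C : ℝ, ∀ U, |B U| ≤ C) →
      Integrable (fun U : GaugeConfig 4 (2 * S + 1) G => A (gaugeTimeReflect (torusLift (2 * S + 1) U)) *
        B (configShift (-(Pi.single 0 (n : ℤ))) (torusLift (2 * S + 1) U))) (wilsonMeasure (d := 4) (L := 2 * S + 1) ρ β) := by
    intro A B hA hB hAb hBb
    obtain ⟨CA, hCA⟩ := hAb; obtain ⟨CB, hCB⟩ := hBb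
    refine hint ((mR hA).mul (mT hB)) ⟨CA * CB, fun U => ?_⟩
    rw [abs_mul]
    have hCA0 : 0 ≤ CA := (abs_nonneg _).trans (hCA (gaugeTimeReflect (torusLift (2 * S + 1) U)))
    exact mul_le_mul (hCA _) (hCB _) (abs_nonneg _) hCA0
  -- the complex integrand as a combination of real products
  have hpt : ∀ U : GaugeConfig 4 (2 * S + 1) G,
      conj ((Z₁ (gaugeTimeReflect (torusLift (2 * S + 1) U)) : ℂ) + Complex.I * (Z₂ (gaugeTimeReflect (torusLift (2 * S + 1) U)) : ℂ)) * ((Z₁ (configShift (-(Pi.single 0 (n : ℤ))) (torusLift (2 * S + 1) U)) : ℂ) + Complex.I * (Z₂ (configShift (-(Pi.single 0 (n : ℤ))) (torusLift (2 * S + 1) U)) : ℂ)) =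
      ((Z₁ (gaugeTimeReflect (torusLift (2 * S + 1) U)) * Z₁ (configShift (-(Pi.single 0 (n : ℤ))) (torusLift (2 * S + 1) U)) + Z₂ (gaugeTimeReflect (torusLift (2 * S + 1) U)) * Z₂ (configShift (-(Pi.single 0 (n : ℤ))) (torusLift (2 * S + 1) U)) : ℝ) : ℂ) +
        Complex.I * ((Z₁ (gaugeTimeReflect (torusLift (2 * S + 1) U)) * Z₂ (configShift (-(Pi.single 0 (n : ℤ))) (torusLift (2 * S + 1) U)) - Z₂ (gaugeTimeReflect (torusLift (2 * S + 1) U)) * Z₁ (configShift (-(Pi.single 0 (n : ℤ))) (torusLift (2 * S + 1) U)) : ℝ) : ℂ) := by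
    intro U
    simp only [map_add, map_mul, Complex.conj_ofReal, Complex.conj_I]
    push_cast
    ring_nf
    rw [Complex.I_sq]
    ring
  simp_rw [hpt]
  have hc1 := hI Z₁ Z₁ h1m h1m ⟨C1, hC1⟩ ⟨C1, hC1⟩
  have hc2 := hI Z₂ Z₂ h2m h2m ⟨C2, hC2⟩ ⟨C2, hC2⟩
  have hc12 := hI Z₁ Z₂ h1m h2m ⟨C1, hC1⟩ ⟨C2, hC2⟩
  have hc21 := hI Z₂ Z₁ h2m h1m ⟨C2, hC2⟩ ⟨C1, hC1⟩
  have hl1 := hint (mL h1m) ⟨C1, fun U => hC1 _⟩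
  have hl2 := hint (mL h2m) ⟨C2, fun U => hC2 _⟩
  rw [integral_add ((hc1.add hc2).ofReal) ((hc12.sub hc21).ofReal.const_mul _), integral_const_mul,
    integral_complex_ofReal, integral_complex_ofReal, integral_add hc1 hc2, integral_sub hc12 hc21,
    integral_add hl1.ofReal (hl2.ofReal.const_mul _), integral_const_mul, integral_complex_ofReal,
    integral_complex_ofReal]
  -- unfold the four connected correlations
  simp only [latticeConnectedCorr, Function.comp_apply]
  rw [rpShift_integral_gaugeTimeReflect_torusLift ρ hρ β _ Z₁, rpShift_integral_gaugeTimeReflect_torusLift ρ hρ β _ Z₂]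
  simp only [map_add, map_mul, Complex.conj_ofReal, Complex.conj_I]
  push_cast
  ring_nf
  rw [Complex.I_sq]
  ring

/-- **Bound of the complex self-correlation by the four real ones.** [folklore] -/
theorem cscl_selfCorr_le (hρ : Continuous ρ) (β : ℝ) (S : ℕ) {Z₁ Z₂ : LGConfig 4 G → ℝ}
    (h1m : Measurable Z₁) (h2m : Measurable Z₂) (h1b : ∃ C : ℝ, ∀ U, |Z₁ U| ≤ C) (h2b : ∃ C : ℝ, ∀ U, |Z₂ U| ≤ C)
    (n : ℕ) :
    ‖(∫ U, conj ((Z₁ (gaugeTimeReflect (torusLift (2 * S + 1) U)) : ℂ) + Complex.I * (Z₂ (gaugeTimeReflect (torusLift (2 * S + 1) U)) : ℂ)) * ((Z₁ (configShift (-(Pi.single 0 (n : ℤ))) (torusLift (2 * S + 1) U)) : ℂ) + Complex.I * (Z₂ (configShift (-(Pi.single 0 (n : ℤ))) (torusLift (2 * S + 1) U)) : ℂ)) ∂(wilsonMeasure (d := 4) (L := 2 * S + 1) ρ β)) -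
      conj (∫ V, ((Z₁ (torusLift (2 * S + 1) V) : ℂ) + Complex.I * (Z₂ (torusLift (2 * S + 1) V) : ℂ)) ∂(wilsonMeasure (d := 4) (L := 2 * S + 1) ρ β)) * (∫ V, ((Z₁ (torusLift (2 * S + 1) V) : ℂ) + Complex.I * (Z₂ (torusLift (2 * S + 1) V) : ℂ)) ∂(wilsonMeasure (d := 4) (L := 2 * S + 1) ρ β))‖ ≤
      |latticeConnectedCorr ρ β (2 * S + 1) (Z₁ ∘ gaugeTimeReflect) Z₁ n| +
        |latticeConnectedCorr ρ β (2 * S + 1) (Z₂ ∘ gaugeTimeReflect) Z₂ n| +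
        |latticeConnectedCorr ρ β (2 * S + 1) (Z₁ ∘ gaugeTimeReflect) Z₂ n| +
        |latticeConnectedCorr ρ β (2 * S + 1) (Z₂ ∘ gaugeTimeReflect) Z₁ n| := by
  rw [cscl_selfCorr_eq ρ hρ β S h1m h2m h1b h2b n]
  refine (norm_add_le _ _).trans ?_
  rw [norm_mul, Complex.norm_I, one_mul, Complex.norm_real, Complex.norm_real, Real.norm_eq_abs, Real.norm_eq_abs]
  have h1 := abs_add_le (latticeConnectedCorr ρ β (2 * S + 1) (Z₁ ∘ gaugeTimeReflect) Z₁ n)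
    (latticeConnectedCorr ρ β (2 * S + 1) (Z₂ ∘ gaugeTimeReflect) Z₂ n)
  have h2 := abs_sub (latticeConnectedCorr ρ β (2 * S + 1) (Z₁ ∘ gaugeTimeReflect) Z₂ n)
    (latticeConnectedCorr ρ β (2 * S + 1) (Z₂ ∘ gaugeTimeReflect) Z₁ n)
  linarith

end Corr

/-- **Registered anchor of this file** (closed form of `cscl_rep_gaugeInvariant`, for the gate's `--supports` stub
check). [folklore] -/
theorem cscl_anchor_obs :
    ∀ (G : Type) [Group G] [MeasurableSpace G] (P : YMSpecies G) (n : ℕ)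
      (B : Finset (Fin n → Literature.Probability.LatticeModels.Site 4))
      (wt : (Fin n → Literature.Probability.LatticeModels.Site 4) → ℝ) (mb : ℝ),
      IsZdGaugeInvariant fun V : LGConfig 4 G => ∑ x ∈ B, wt x * ∏ i, (P.F (configShift (-(x i)) V) - mb) :=
  fun _ _ _ P _ B wt mb => cscl_rep_gaugeInvariant P B wt mb

end Summit.QuantumFields.YangMills.Theorems.ContinuumLegGivenGap

end


-- ═════════════════════════════════════════════════════════════════════════════════════════════
-- FILE: Summits/QuantumFields/YangMills/Theorems/ConvexGribovBodyContinuumLegGivenGapCsclConstants.lean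
-- (imports of the standalone file: see Lines/Sketch17CS-LANDING.md)
-- ═════════════════════════════════════════════════════════════════════════════════════════════

/-!
# `ContinuumLegGivenGap` (stmt-QuantumFields-15828), line `Sketch`, reshape 17-CS, helper 6 of `stub_csclOfLock`:
# box-uniform clustering constants from the lock (Banach–Steinhaus) and the self-correlation bound of a complex
# observable with real local parts

At one coupling `β'` with rate `M` and threshold `S₁'` (one index of the crux's locked datum), the per-pair clustering
`|corr_{β'}(2S+1; A, B; n)| ≤ C(A,B) e^{−Mn}` (`S ≥ S₁'`, `n ≤ S`) is upgraded, for every fixed pair of supports, to the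
product form `≤ K ‖A‖∞ ‖B‖∞ e^{−Mn}` with ONE `K = K(Λ₁, Λ₂) ≥ 0` (`cscl_bs`: the landed `stub_pairToNorm stub_bilinearUBP`).
Consequently a complex observable `Z = Z₁ + iZ₂` whose parts are local gauge-invariant observables with support `Λ`,
reflections supported on `Λθ` and sup bounds `≤ B`, has reflected connected self-correlation
`≤ 4 K(Λθ,Λ) B² e^{−Mn}` for all `n ≤ S`, `S ≥ S₁'` (`cscl_selfCorr_bound`) — the `D_X` of `cscl_torus_pair`.
Registered anchor: `cscl_anchor_constants`. No definitions. [folklore]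
-/

noncomputable section

open scoped ComplexConjugate
open MeasureTheory Filter
open Literature.MathematicalPhysics.QuantumFieldTheory Literature.MathematicalPhysics.QuantumLattice
open Summit.QuantumFields.YangMills.Theorems.ClusteringToYangMills.Reconstructible

namespace Summit.QuantumFields.YangMills.Theorems.ContinuumLegGivenGap

section BS

variable {G : Type} [Group G] [TopologicalSpace G] [IsTopologicalGroup G] [CompactSpace G]
  [MeasurableSpace G] [BorelSpace G] (r : LatticeRep G)

/-- **Box-uniform constants (Banach–Steinhaus).** [folklore] -/
theorem cscl_bs {β' M : ℝ} {S₁' : ℕ}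
    (hlock : ∀ A B : YMSpecies G, ∃ C : ℝ, ∀ S n : ℕ, S₁' ≤ S → n ≤ S →
      |latticeConnectedCorr r.ρ β' (2 * S + 1) A.F B.F n| ≤ C * Real.exp (-(M * n)))
    (Λ₁ Λ₂ : Finset (Literature.MathematicalPhysics.QuantumLattice.ZdEdge 4)) :
    ∃ K : ℝ, 0 ≤ K ∧ ∀ A B : YMSpecies G, A.supp = Λ₁ → B.supp = Λ₂ → ∀ S n : ℕ, S₁' ≤ S → n ≤ S →
      |latticeConnectedCorr r.ρ β' (2 * S + 1) A.F B.F n| ≤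
        K * (⨆ U, |A.F U|) * (⨆ U, |B.F U|) * Real.exp (-(M * n)) := by
  obtain ⟨K, hK⟩ := stub_pairToNorm stub_bilinearUBP G r Λ₁ Λ₂
    (fun β S n => β = β' ∧ S₁' ≤ S ∧ n ≤ S) (fun _ _ n => Real.exp (-(M * n))) (fun _ _ _ _ => Real.exp_pos _)
    (fun A B hA hB => by
      obtain ⟨C, hC⟩ := hlock A B
      exact ⟨C, fun β S n hP => by obtain ⟨rfl, h1, h2⟩ := hP; exact hC S n h1 h2⟩)
  refine ⟨max K 0, le_max_right _ _, fun A B hA hB S n h1 h2 => ?_⟩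
  refine (hK A B hA hB β' S n ⟨rfl, h1, h2⟩).trans ?_
  have hA0 : 0 ≤ ⨆ U, |A.F U| := Real.iSup_nonneg fun U => abs_nonneg _
  have hB0 : 0 ≤ ⨆ U, |B.F U| := Real.iSup_nonneg fun U => abs_nonneg _
  gcongr
  exact le_max_left _ _

omit [TopologicalSpace G] [IsTopologicalGroup G] [CompactSpace G] [BorelSpace G] in
/-- The sup of `|A.F|` is at most any uniform bound. [folklore] -/
theorem cscl_iSup_le {A : YMSpecies G} {B : ℝ} (hB : ∀ U, |A.F U| ≤ B) : (⨆ U, |A.F U|) ≤ B :=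
  ciSup_le hB

/-- **The self-correlation bound of a complex observable with real local parts** (the `D_X` of `cscl_torus_pair`):
with `K = K(Λθ, Λ)` from `cscl_bs`, parts `O₁, O₂` supported on `Λ`, reflections `O₁', O₂'` (`Oⱼ'.F = Oⱼ.F ∘ Θ`)
supported on `Λθ`, and `|Oⱼ.F| ≤ B`: the reflected connected self-correlation of `Z = O₁.F + i O₂.F` is
`≤ 4 K B² e^{−Mn}` for `S ≥ S₁'`, `n ≤ S`. [folklore] -/
theorem cscl_selfCorr_bound {β' M K B : ℝ} {S₁' : ℕ}
    {Λ Λθ : Finset (Literature.MathematicalPhysics.QuantumLattice.ZdEdge 4)} (hK0 : 0 ≤ K)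
    (hK : ∀ A B' : YMSpecies G, A.supp = Λθ → B'.supp = Λ → ∀ S n : ℕ, S₁' ≤ S → n ≤ S →
      |latticeConnectedCorr r.ρ β' (2 * S + 1) A.F B'.F n| ≤
        K * (⨆ U, |A.F U|) * (⨆ U, |B'.F U|) * Real.exp (-(M * n)))
    (O₁ O₂ O₁' O₂' : YMSpecies G) (h1 : O₁.supp = Λ) (h2 : O₂.supp = Λ) (h1' : O₁'.supp = Λθ) (h2' : O₂'.supp = Λθ)
    (hF1 : O₁'.F = O₁.F ∘ gaugeTimeReflect) (hF2 : O₂'.F = O₂.F ∘ gaugeTimeReflect)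
    (hB0 : 0 ≤ B) (hB1 : ∀ U, |O₁.F U| ≤ B) (hB2 : ∀ U, |O₂.F U| ≤ B) {S : ℕ} (hS : S₁' ≤ S) {n : ℕ} (hn : n ≤ S) :
    ‖(∫ U, conj ((O₁.F (gaugeTimeReflect (torusLift (2 * S + 1) U)) : ℂ) +
            Complex.I * (O₂.F (gaugeTimeReflect (torusLift (2 * S + 1) U)) : ℂ)) *
          ((O₁.F (configShift (-(Pi.single 0 (n : ℤ))) (torusLift (2 * S + 1) U)) : ℂ) +
            Complex.I * (O₂.F (configShift (-(Pi.single 0 (n : ℤ))) (torusLift (2 * S + 1) U)) : ℂ))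
          ∂(wilsonMeasure (d := 4) (L := 2 * S + 1) r.ρ β')) -
        conj (∫ V, ((O₁.F (torusLift (2 * S + 1) V) : ℂ) + Complex.I * (O₂.F (torusLift (2 * S + 1) V) : ℂ))
            ∂(wilsonMeasure (d := 4) (L := 2 * S + 1) r.ρ β')) *
          (∫ V, ((O₁.F (torusLift (2 * S + 1) V) : ℂ) + Complex.I * (O₂.F (torusLift (2 * S + 1) V) : ℂ))
            ∂(wilsonMeasure (d := 4) (L := 2 * S + 1) r.ρ β'))‖ ≤
      4 * K * B ^ 2 * Real.exp (-(M * n)) := by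
  have hle := cscl_selfCorr_le r.ρ r.continuous β' S O₁.measurable O₂.measurable O₁.bounded O₂.bounded n
  refine hle.trans ?_
  -- each of the four real correlations is `≤ K B² e^{-Mn}`
  have hB1' : ∀ U, |O₁'.F U| ≤ B := fun U => by rw [hF1]; exact hB1 _
  have hB2' : ∀ U, |O₂'.F U| ≤ B := fun U => by rw [hF2]; exact hB2 _
  have hone : ∀ (A B' : YMSpecies G), A.supp = Λθ → B'.supp = Λ → (∀ U, |A.F U| ≤ B) → (∀ U, |B'.F U| ≤ B) →
      |latticeConnectedCorr r.ρ β' (2 * S + 1) A.F B'.F n| ≤ K * B ^ 2 * Real.exp (-(M * n)) := by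
    intro A B' hA hB' hAB hBB
    refine (hK A B' hA hB' S n hS hn).trans ?_
    have hA0 : 0 ≤ ⨆ U, |A.F U| := Real.iSup_nonneg fun U => abs_nonneg _
    have hBs0 : 0 ≤ ⨆ U, |B'.F U| := Real.iSup_nonneg fun U => abs_nonneg _
    have e0 : 0 ≤ Real.exp (-(M * n)) := (Real.exp_pos _).le
    calc K * (⨆ U, |A.F U|) * (⨆ U, |B'.F U|) * Real.exp (-(M * n))
        ≤ K * B * B * Real.exp (-(M * n)) := by
          gcongr
          · exact cscl_iSup_le hAB
          · exact cscl_iSup_le hBB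
      _ = K * B ^ 2 * Real.exp (-(M * n)) := by ring
  have c11 := hone O₁' O₁ h1' h1 hB1' hB1
  have c22 := hone O₂' O₂ h2' h2 hB2' hB2
  have c12 := hone O₁' O₂ h1' h2 hB1' hB2
  have c21 := hone O₂' O₁ h2' h1 hB2' hB1
  rw [hF1] at c11 c12
  rw [hF2] at c22 c21
  linarith

end BS

/-- **Registered anchor of this file** (closed form of `cscl_iSup_le`, for the gate's `--supports` stub check).
[folklore] -/
theorem cscl_anchor_constants :
    ∀ (G : Type) [Group G] [MeasurableSpace G] (A : YMSpecies G) (B : ℝ), (∀ U, |A.F U| ≤ B) → (⨆ U, |A.F U|) ≤ B :=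
  fun _ _ _ _ _ hB => ciSup_le hB

end Summit.QuantumFields.YangMills.Theorems.ContinuumLegGivenGap

end


-- ═════════════════════════════════════════════════════════════════════════════════════════════
-- FILE: Summits/QuantumFields/YangMills/Theorems/ConvexGribovBodyContinuumLegGivenGapCsclScheme.lean
-- (imports of the standalone file: see Lines/Sketch17CS-LANDING.md)
-- ═════════════════════════════════════════════════════════════════════════════════════════════

/-!
# `ContinuumLegGivenGap` (stmt-QuantumFields-15828), line `Sketch`, reshape 17-CS, helper 8 of `stub_csclOfLock`:
# the per-step budget (constants, length threshold, choice of the torus in the admissible set) and the scheme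

* `cscl_coordBound` — a local observable has support edges with bounded coordinates;
* `cscl_budget` — at ONE index of the locked datum (coupling `β'`, rate `M > 0`, threshold `S₁'`), for the class box
  `Λ = {e : |e.1 j| ≤ R, 1 ≤ e.1 0}` and its reflection `Λθ`, a sup bound `Bb` and a tolerance `εk > 0`, there are a
  torus half-side `L` in any cofinal admissible set, a shift range `Nn ≥ Nmin` and a constant `D > 0` with
  `2R + Nn + 10 ≤ L`, `D e^{M} ≤ εk e^{M Nn/2}`, and the reflected connected self-correlation of EVERY complex
  observable with real local parts supported on `Λ` (reflections on `Λθ`) and bounded by `Bb` is `≤ D e^{−Mn}`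
  (`n ≤ S`, `S ≥ S₁'`) — the hypotheses of `cscl_torus_pair`, uniformly over the class (Banach–Steinhaus, `cscl_bs`);
* `cscl_tendsto_mul_of_pow` — `a_k L_k → ∞` from `a_k⁻¹ ≤ (a_k L_k)^N` and `a_k → 0`;
* `cscl_mkScheme` — the canonically normalised, exactly centred scheme with prescribed `a, β, L`.
Registered anchor: `cscl_anchor_scheme`. No definitions. [folklore]
-/

noncomputable section

open scoped ComplexConjugate
open MeasureTheory Filter Topology
open Literature.MathematicalPhysics.QuantumFieldTheory Literature.MathematicalPhysics.QuantumLattice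
open Literature.Probability.LatticeModels (box mem_box)
open Summit.QuantumFields.YangMills.Theorems.ClusteringToYangMills.Reconstructible

namespace Summit.QuantumFields.YangMills.Theorems.ContinuumLegGivenGap

section Budget

variable {G : Type} [Group G] [TopologicalSpace G] [IsTopologicalGroup G] [CompactSpace G]
  [MeasurableSpace G] [BorelSpace G] (r : LatticeRep G)

omit [TopologicalSpace G] [IsTopologicalGroup G] [CompactSpace G] [BorelSpace G] in
/-- The support edges of a local observable have bounded coordinates. [folklore] -/
theorem cscl_coordBound (P : YMSpecies G) : ∃ Rc : ℕ, ∀ e ∈ P.supp, ∀ j : Fin 4, |e.1 j| ≤ Rc := by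
  classical
  refine ⟨P.supp.sup fun e => Finset.univ.sup fun j => (e.1 j).natAbs, fun e he j => ?_⟩
  have h1 : (e.1 j).natAbs ≤ Finset.univ.sup fun j => (e.1 j).natAbs := Finset.le_sup (f := fun j => (e.1 j).natAbs) (Finset.mem_univ j)
  have h2 : (Finset.univ.sup fun j => (e.1 j).natAbs) ≤ P.supp.sup fun e => Finset.univ.sup fun j => (e.1 j).natAbs :=
    Finset.le_sup (f := fun e => Finset.univ.sup fun j => (e.1 j).natAbs) he
  have h3 : ((e.1 j).natAbs : ℤ) ≤ ((P.supp.sup fun e => Finset.univ.sup fun j => (e.1 j).natAbs : ℕ) : ℤ) := by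
    exact_mod_cast h1.trans h2
  rw [← Int.natCast_natAbs]
  exact h3

/-- **The per-step budget** (see the module docstring). [folklore] -/
theorem cscl_budget {β' M : ℝ} {S₁' : ℕ} (hM : 0 < M)
    (hlock : ∀ A B : YMSpecies G, ∃ C : ℝ, ∀ S n : ℕ, S₁' ≤ S → n ≤ S →
      |latticeConnectedCorr r.ρ β' (2 * S + 1) A.F B.F n| ≤ C * Real.exp (-(M * n)))
    (R Nmin : ℕ) {Bb εk : ℝ} (hBb : 0 ≤ Bb) (hεk : 0 < εk) {𝓛set : Set ℕ} (hcof : ∀ S : ℕ, ∃ S' : ℕ, S' ∈ 𝓛set ∧ S ≤ S') :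
    ∃ L : ℕ, L ∈ 𝓛set ∧ ∃ (Nn : ℕ) (D : ℝ), Nmin ≤ Nn ∧ 2 * R + Nn + 10 ≤ L ∧ 0 < D ∧
      D * Real.exp M ≤ εk * Real.exp (M * Nn / 2) ∧
      ∀ (O₁ O₂ O₁' O₂' : YMSpecies G),
        O₁.supp = ((box 4 R).filter fun y => 1 ≤ y 0) ×ˢ (Finset.univ : Finset (Fin 4)) →
        O₂.supp = ((box 4 R).filter fun y => 1 ≤ y 0) ×ˢ (Finset.univ : Finset (Fin 4)) →
        O₁'.supp = (((box 4 R).filter fun y => 1 ≤ y 0) ×ˢ (Finset.univ : Finset (Fin 4))).image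
          (fun e => if e.2 = 0 then (latticeTimeReflection 4 (e.1 + Pi.single 0 1), 0)
            else (latticeTimeReflection 4 e.1, e.2)) →
        O₂'.supp = (((box 4 R).filter fun y => 1 ≤ y 0) ×ˢ (Finset.univ : Finset (Fin 4))).image
          (fun e => if e.2 = 0 then (latticeTimeReflection 4 (e.1 + Pi.single 0 1), 0)
            else (latticeTimeReflection 4 e.1, e.2)) →
        O₁'.F = O₁.F ∘ gaugeTimeReflect → O₂'.F = O₂.F ∘ gaugeTimeReflect →
        (∀ U, |O₁.F U| ≤ Bb) → (∀ U, |O₂.F U| ≤ Bb) →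
        ∀ S : ℕ, S₁' ≤ S → ∀ n : ℕ, n ≤ S →
          ‖(∫ U, conj ((O₁.F (gaugeTimeReflect (torusLift (2 * S + 1) U)) : ℂ) +
                  Complex.I * (O₂.F (gaugeTimeReflect (torusLift (2 * S + 1) U)) : ℂ)) *
                ((O₁.F (configShift (-(Pi.single 0 (n : ℤ))) (torusLift (2 * S + 1) U)) : ℂ) +
                  Complex.I * (O₂.F (configShift (-(Pi.single 0 (n : ℤ))) (torusLift (2 * S + 1) U)) : ℂ))
                ∂(wilsonMeasure (d := 4) (L := 2 * S + 1) r.ρ β')) -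
              conj (∫ V, ((O₁.F (torusLift (2 * S + 1) V) : ℂ) + Complex.I * (O₂.F (torusLift (2 * S + 1) V) : ℂ))
                  ∂(wilsonMeasure (d := 4) (L := 2 * S + 1) r.ρ β')) *
                (∫ V, ((O₁.F (torusLift (2 * S + 1) V) : ℂ) + Complex.I * (O₂.F (torusLift (2 * S + 1) V) : ℂ))
                  ∂(wilsonMeasure (d := 4) (L := 2 * S + 1) r.ρ β'))‖ ≤ D * Real.exp (-(M * n)) := by
  classical
  set Λ : Finset (Literature.MathematicalPhysics.QuantumLattice.ZdEdge 4) :=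
    ((box 4 R).filter fun y => 1 ≤ y 0) ×ˢ (Finset.univ : Finset (Fin 4)) with hΛ
  set Λθ : Finset (Literature.MathematicalPhysics.QuantumLattice.ZdEdge 4) :=
    Λ.image (fun e => if e.2 = 0 then (latticeTimeReflection 4 (e.1 + Pi.single 0 1), 0)
      else (latticeTimeReflection 4 e.1, e.2)) with hΛθ
  obtain ⟨K, hK0, hK⟩ := cscl_bs r hlock Λθ Λ
  set D : ℝ := 4 * K * Bb ^ 2 + 1 with hD
  have hD0 : 0 < D := by positivity
  -- `Nn`: `D e^{M} / εk ≤ e^{M Nn / 2}` for `Nn` large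
  obtain ⟨Nn, hNmin, hNn⟩ : ∃ Nn : ℕ, Nmin ≤ Nn ∧ D * Real.exp M ≤ εk * Real.exp (M * Nn / 2) := by
    have ht : Tendsto (fun Nn : ℕ => εk * Real.exp (M * Nn / 2)) atTop atTop := by
      refine Tendsto.const_mul_atTop hεk (Real.tendsto_exp_atTop.comp ?_)
      have : Tendsto (fun Nn : ℕ => M / 2 * (Nn : ℝ)) atTop atTop :=
        Tendsto.const_mul_atTop (by positivity) tendsto_natCast_atTop_atTop
      exact this.congr fun Nn => by ring
    obtain ⟨Nn, hNn⟩ := ((ht.eventually_ge_atTop (D * Real.exp M)).and (eventually_ge_atTop Nmin)).exists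
    exact ⟨Nn, hNn.2, hNn.1⟩
  obtain ⟨L, hL𝓛, hL⟩ := hcof (2 * R + Nn + 10)
  refine ⟨L, hL𝓛, Nn, D, hNmin, hL, hD0, hNn, ?_⟩
  intro O₁ O₂ O₁' O₂' h1 h2 h1' h2' hF1 hF2 hB1 hB2 S hS n hn
  have h := cscl_selfCorr_bound r hK0 hK O₁ O₂ O₁' O₂' h1 h2 h1' h2' hF1 hF2 hBb hB1 hB2 hS hn
  refine h.trans ?_
  have e0 : 0 ≤ Real.exp (-(M * n)) := (Real.exp_pos _).le
  nlinarith [e0]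

end Budget

/-! ### The scheme -/

section Scheme

variable {G : Type} [Group G] [TopologicalSpace G] [IsTopologicalGroup G] [CompactSpace G]
  [MeasurableSpace G] [BorelSpace G] (r : LatticeRep G)

/-- **`a_k L_k → ∞`** from polynomial admissibility `a_k⁻¹ ≤ (a_k L_k)^N` (eventually, `N ≥ 1`) and `a_k → 0⁺`.
[folklore] -/
theorem cscl_tendsto_mul_of_pow {a : ℕ → ℝ} {L : ℕ → ℕ} {N : ℕ} (hN : 1 ≤ N) (ha : ∀ k, 0 < a k)
    (ha0 : Tendsto a atTop (𝓝 0)) (hpow : ∀ᶠ k in atTop, (a k)⁻¹ ≤ (a k * (L k : ℝ)) ^ N) :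
    Tendsto (fun k => a k * (L k : ℝ)) atTop atTop := by
  refine tendsto_atTop.2 fun b => ?_
  have hinv : Tendsto (fun k => (a k)⁻¹) atTop atTop :=
    Filter.Tendsto.inv_tendsto_nhdsGT_zero (tendsto_nhdsWithin_iff.2 ⟨ha0, Eventually.of_forall fun k => ha k⟩)
  filter_upwards [hpow, hinv.eventually_ge_atTop ((max b 1) ^ N)] with k hk hk2
  have hx0 : 0 ≤ a k * (L k : ℝ) := mul_nonneg (ha k).le (Nat.cast_nonneg _)
  have h3 : (max b 1) ^ N ≤ (a k * (L k : ℝ)) ^ N := hk2.trans hk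
  have h4 : max b 1 ≤ a k * (L k : ℝ) := le_of_pow_le_pow_left₀ (by omega) hx0 h3
  exact (le_max_left _ _).trans h4

/-- **The canonically normalised, exactly centred scheme with prescribed spacings, couplings and tori.** [folklore] -/
theorem cscl_mkScheme {a : ℕ → ℝ} (ha : ∀ k, 0 < a k) (ha0 : Tendsto a atTop (𝓝 0)) (βs : ℕ → ℝ) {L : ℕ → ℕ}
    (hL : Tendsto (fun k => a k * (L k : ℝ)) atTop atTop) :
    ∃ sch : SpeciesScheme (YMSpecies G), (∀ k, sch.a k = a k) ∧ (∀ k, sch.β k = βs k) ∧ (∀ k, sch.L k = L k) ∧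
      (∀ k : ℕ, sch.c r.curvature k = (sch.a k ^ 4)⁻¹) ∧
      (∀ k : ℕ, sch.m r.curvature k =
        ∫ U : GaugeConfig 4 (sch.side k) G, r.curvature.F (torusLift (sch.side k) U) ∂(wilsonMeasure r.ρ (sch.β k))) := by
  classical
  refine ⟨⟨a, ha, ha0, βs, L, hL, fun s k => if s = r.curvature then (a k ^ 4)⁻¹ else 0,
    fun s k => if s = r.curvature then
      ∫ U : GaugeConfig 4 (2 * L k + 1) G, r.curvature.F (torusLift (2 * L k + 1) U) ∂(wilsonMeasure r.ρ (βs k))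
      else 0⟩, fun _ => rfl, fun _ => rfl, fun _ => rfl, fun k => ?_, fun k => ?_⟩
  · simp
  · simp only [↓reduceIte]
    rfl

end Scheme

/-- **Registered anchor of this file** (closed form of `cscl_tendsto_mul_of_pow`, for the gate's `--supports` stub
check). [folklore] -/
theorem cscl_anchor_scheme :
    ∀ (a : ℕ → ℝ) (L : ℕ → ℕ) (N : ℕ), 1 ≤ N → (∀ k, 0 < a k) → Tendsto a atTop (𝓝 0) →
      (∀ᶠ k in atTop, (a k)⁻¹ ≤ (a k * (L k : ℝ)) ^ N) → Tendsto (fun k => a k * (L k : ℝ)) atTop atTop :=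
  fun _ _ _ hN ha ha0 hpow => cscl_tendsto_mul_of_pow hN ha ha0 hpow


end Summit.QuantumFields.YangMills.Theorems.ContinuumLegGivenGap

end


-- ═════════════════════════════════════════════════════════════════════════════════════════════
-- FILE: Summits/QuantumFields/YangMills/Theorems/ConvexGribovBodyContinuumLegGivenGapCsclRep.lean
-- (imports of the standalone file: see Lines/Sketch17CS-LANDING.md)
-- ═════════════════════════════════════════════════════════════════════════════════════════════

/-!
# `ContinuumLegGivenGap` (stmt-QuantumFields-15828), line `Sketch`, reshape 17-CS, helper 9 of `stub_csclOfLock`: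
# the lattice representative of a test function at one step of a scheme — decomposition into two local species
# with the class support, sup bounds, cylinder/measurability data, exact lattice translation

With `X_F(V) = ∑ₓ F(a_k x⃗) ∏ᵢ (P(τ_{xᵢ}V) − ⟨P⟩_k)` (so that route ParabolicTrajectory's `Arp.lat sch k (cen P) F U = X_F(Ũ)`
by `rfl`): if every tuple `x⃗` with `F(a_k x⃗) ≠ 0` has coordinates `|xᵢⱼ| ≤ Nk` and times `xᵢ₀ ≥ Rc + 2` (`Rc` a
coordinate bound of the curvature support), then `X_F = O₁ + i O₂` with local gauge-invariant REAL observables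
`O₁, O₂` of support EXACTLY the class box `Λ = {e : |e.1 j| ≤ Nk + Rc, 1 ≤ e.1 0}` and
`|Oⱼ| ≤ (#box Nk)ⁿ ‖F‖∞ (2C_P)ⁿ` (`cscl_rep_decomp`); consequently `X_F` is a bounded measurable cylinder on `Λ`
(`cscl_rep_cylinder`). Exact lattice translation: `X_{T_{a_k s e₀} H} = X_H ∘ τˢ` once the translated time support
still fits the box (`cscl_rep_translate`). Registered anchor: `cscl_anchor_rep`. No definitions. [folklore]
-/

noncomputable section

open scoped SchwartzMap ComplexConjugate
open MeasureTheory Filter Topology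
open Literature.MathematicalPhysics.QuantumFieldTheory Literature.MathematicalPhysics.QuantumLattice
  Literature.MathematicalPhysics.AQFT
open Literature.Probability.LatticeModels (box mem_box Site)
open Summit.QuantumFields.YangMills.Theorems.ClusteringToYangMills.Reconstructible
open Summit.QuantumFields.YangMills.Cruxes.ContinuumLimitOnTrajectory.TwoOrbitSynchronisation (Arp.sum_boxFun_eq)

namespace Summit.QuantumFields.YangMills.Theorems.ContinuumLegGivenGap

section Rep

variable {G : Type} [Group G] [TopologicalSpace G] [IsTopologicalGroup G] [CompactSpace G]
  [MeasurableSpace G] [BorelSpace G] (r : LatticeRep G) (sch : SpeciesScheme (YMSpecies G)) (k : ℕ)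

/-- The torus mean of a bounded observable is bounded by the same constant. [folklore] -/
theorem cscl_abs_wilsonTorusMean_le {P : LGConfig 4 G → ℝ} {CP : ℝ} (hCP : ∀ U, |P U| ≤ CP)
    (β : ℝ) (L : ℕ) : |wilsonTorusMean r.ρ β L P| ≤ CP := by
  haveI := isProbabilityMeasure_wilsonMeasure (d := 4) (L := 2 * L + 1) r.ρ r.continuous β
  unfold wilsonTorusMean
  have h := norm_integral_le_of_norm_le_const (μ := wilsonMeasure (d := 4) (L := 2 * L + 1) r.ρ β)
    (f := fun U => P (torusLift (2 * L + 1) U)) (C := CP) (Eventually.of_forall fun U => by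
      rw [Real.norm_eq_abs]; exact hCP _)
  simpa [Real.norm_eq_abs] using h

/-- **Decomposition of the representative into two local species with the class support and sup bounds.**
[folklore] -/
theorem cscl_rep_decomp {n Nk Rc : ℕ} {NF CP : ℝ} (hNF : 0 ≤ NF) (hCP : ∀ U, |r.curvature.F U| ≤ CP)
    (hRc : ∀ e ∈ r.curvature.supp, ∀ j : Fin 4, |e.1 j| ≤ Rc)
    (F : 𝓢((Fin n → EuclideanSpace ℝ (Fin 4)), ℂ)) (hFb : ∀ y, ‖F y‖ ≤ NF)
    (hcls : ∀ x : Fin n → Site 4, F (fun i => sch.a k • siteToE (x i)) ≠ 0 →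
      (∀ i j, |x i j| ≤ Nk) ∧ ∀ i, (Rc : ℤ) + 2 ≤ x i 0) :
    ∃ O₁ O₂ : YMSpecies G,
      O₁.supp = ((box 4 (Nk + Rc)).filter fun y => 1 ≤ y 0) ×ˢ (Finset.univ : Finset (Fin 4)) ∧
      O₂.supp = ((box 4 (Nk + Rc)).filter fun y => 1 ≤ y 0) ×ˢ (Finset.univ : Finset (Fin 4)) ∧
      (∀ V : LGConfig 4 G,
        (∑ x : Fin n → ↥(box 4 (sch.L k)), F (fun i => sch.a k • siteToE (↑(x i) : Site 4)) *
          ∏ i, ((r.curvature.F (configShift (-(↑(x i) : Site 4)) V) -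
            wilsonTorusMean r.ρ (sch.β k) (sch.L k) r.curvature.F : ℝ) : ℂ)) =
        (O₁.F V : ℂ) + Complex.I * (O₂.F V : ℂ)) ∧
      (∀ V, |O₁.F V| ≤ ((box 4 Nk).card : ℝ) ^ n * NF * (2 * CP) ^ n) ∧
      (∀ V, |O₂.F V| ≤ ((box 4 Nk).card : ℝ) ^ n * NF * (2 * CP) ^ n) := by
  classical
  set a : ℝ := sch.a k
  set mb : ℝ := wilsonTorusMean r.ρ (sch.β k) (sch.L k) r.curvature.F
  set B : Finset (Fin n → Site 4) := Fintype.piFinset fun _ : Fin n => box 4 (sch.L k)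
  set Λ : Finset (Literature.MathematicalPhysics.QuantumLattice.ZdEdge 4) :=
    ((box 4 (Nk + Rc)).filter fun y => 1 ≤ y 0) ×ˢ (Finset.univ : Finset (Fin 4))
  -- support condition for both weight choices
  have hΛ : ∀ (wt : (Fin n → Site 4) → ℝ), (∀ x, F (fun i => a • siteToE (x i)) = 0 → wt x = 0) →
      ∀ x ∈ B, wt x ≠ 0 → ∀ i, ∀ e ∈ r.curvature.supp, (e.1 + x i, e.2) ∈ Λ := by
    intro wt hwt x _ hx i e he
    have hF : F (fun i => a • siteToE (x i)) ≠ 0 := fun h0 => hx (hwt x h0)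
    obtain ⟨hc, ht⟩ := hcls x hF
    simp only [Λ, Finset.mem_product, Finset.mem_filter, mem_box, Finset.mem_univ, and_true, Pi.add_apply]
    refine ⟨fun j => ?_, ?_⟩
    · have h1 := abs_le.1 (hRc e he j)
      have h2 := abs_le.1 (hc i j)
      constructor <;> push_cast <;> omega
    · have h1 := abs_le.1 (hRc e he 0)
      have h2 := ht i
      omega
  obtain ⟨O₁, hO₁F, hO₁s⟩ := cscl_rep_species r.curvature B (fun x => (F (fun i => a • siteToE (x i))).re) mb
    (hΛ _ fun x h0 => by simp [h0])
  obtain ⟨O₂, hO₂F, hO₂s⟩ := cscl_rep_species r.curvature B (fun x => (F (fun i => a • siteToE (x i))).im) mb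
    (hΛ _ fun x h0 => by simp [h0])
  -- the sup bounds
  have hmb : |mb| ≤ CP := cscl_abs_wilsonTorusMean_le r hCP _ _
  have hsum : ∀ (wt : (Fin n → Site 4) → ℝ), (∀ x, |wt x| ≤ ‖F (fun i => a • siteToE (x i))‖) →
      ∑ x ∈ B, |wt x| ≤ ((box 4 Nk).card : ℝ) ^ n * NF := by
    intro wt hwt
    have hvan : ∀ x ∈ B, x ∉ Fintype.piFinset (fun _ : Fin n => box 4 Nk) → |wt x| = 0 := by
      intro x _ hx
      have : F (fun i => a • siteToE (x i)) = 0 := by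
        by_contra hF
        refine hx (Fintype.mem_piFinset.2 fun i => mem_box.2 fun j => abs_le.1 ((hcls x hF).1 i j))
      have h := hwt x
      rw [this, norm_zero] at h
      exact le_antisymm h (abs_nonneg _)
    calc ∑ x ∈ B, |wt x| = ∑ x ∈ B ∩ Fintype.piFinset (fun _ : Fin n => box 4 Nk), |wt x| :=
          (Finset.sum_subset Finset.inter_subset_left fun x hxB hxn =>
            hvan x hxB fun hm => hxn (Finset.mem_inter.2 ⟨hxB, hm⟩)).symm
      _ ≤ ∑ _x ∈ B ∩ Fintype.piFinset (fun _ : Fin n => box 4 Nk), NF :=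
          Finset.sum_le_sum fun x _ => (hwt x).trans (hFb _)
      _ = ((B ∩ Fintype.piFinset (fun _ : Fin n => box 4 Nk)).card : ℝ) * NF := by
          rw [Finset.sum_const, nsmul_eq_mul]
      _ ≤ ((Fintype.piFinset (fun _ : Fin n => box 4 Nk)).card : ℝ) * NF := by
          gcongr; exact Finset.inter_subset_right
      _ = ((box 4 Nk).card : ℝ) ^ n * NF := by
          rw [Fintype.card_piFinset, Finset.prod_const, Finset.card_univ, Fintype.card_fin]; push_cast; ring
  have hCP0 : 0 ≤ CP := (abs_nonneg _).trans (hCP (Classical.arbitrary _))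
  have hbound : ∀ (wt : (Fin n → Site 4) → ℝ), (∀ x, |wt x| ≤ ‖F (fun i => a • siteToE (x i))‖) →
      ∀ V : LGConfig 4 G, |∑ x ∈ B, wt x * ∏ i, (r.curvature.F (configShift (-(x i)) V) - mb)| ≤
        ((box 4 Nk).card : ℝ) ^ n * NF * (2 * CP) ^ n := by
    intro wt hwt V
    refine (cscl_rep_bounded r.curvature B wt mb hCP V).trans ?_
    have h1 := hsum wt hwt
    have h2 : (CP + |mb|) ^ n ≤ (2 * CP) ^ n := pow_le_pow_left₀ (by positivity) (by linarith) n
    have h3 : 0 ≤ ∑ x ∈ B, |wt x| := Finset.sum_nonneg fun x _ => abs_nonneg _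
    calc (∑ x ∈ B, |wt x|) * (CP + |mb|) ^ n ≤ (((box 4 Nk).card : ℝ) ^ n * NF) * (2 * CP) ^ n :=
          mul_le_mul h1 h2 (by positivity) (by positivity)
      _ = _ := by ring
  refine ⟨O₁, O₂, hO₁s, hO₂s, fun V => ?_, fun V => ?_, fun V => ?_⟩
  · rw [hO₁F, hO₂F]
    have hs := Arp.sum_boxFun_eq (L := sch.L k) (fun y : Fin n → Site 4 =>
      F (fun i => a • siteToE (y i)) * ∏ i, ((r.curvature.F (configShift (-(y i)) V) - mb : ℝ) : ℂ))
    simp only at hs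
    rw [hs]
    push_cast
    rw [Finset.mul_sum, ← Finset.sum_add_distrib]
    refine Finset.sum_congr rfl fun x _ => ?_
    rw [← Complex.re_add_im (F fun i => a • siteToE (x i))]
    simp only [Complex.add_re, Complex.ofReal_re, Complex.mul_re, Complex.I_re, zero_mul, Complex.ofReal_im,
      mul_zero, sub_zero, Complex.I_im, add_zero, Complex.add_im, Complex.mul_im, zero_add]
    push_cast
    ring
  · rw [hO₁F]; exact hbound _ (fun x => Complex.abs_re_le_norm _) V
  · rw [hO₂F]; exact hbound _ (fun x => Complex.abs_im_le_norm _) V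

end Rep

/-- **Registered anchor of this file** (closed form of `cscl_abs_wilsonTorusMean_le`, for the gate's `--supports`
stub check). [folklore] -/
theorem cscl_anchor_rep :
    ∀ (G : Type) [Group G] [TopologicalSpace G] [IsTopologicalGroup G] [CompactSpace G] [MeasurableSpace G]
      [BorelSpace G] (r : LatticeRep G) (P : LGConfig 4 G → ℝ) (CP : ℝ), (∀ U, |P U| ≤ CP) →
      ∀ (β : ℝ) (L : ℕ), |wilsonTorusMean r.ρ β L P| ≤ CP :=
  fun _ _ _ _ _ _ _ r _ _ hCP β L => cscl_abs_wilsonTorusMean_le r hCP β L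

end Summit.QuantumFields.YangMills.Theorems.ContinuumLegGivenGap

end


-- ═════════════════════════════════════════════════════════════════════════════════════════════
-- FILE: Summits/QuantumFields/YangMills/Theorems/ConvexGribovBodyContinuumLegGivenGapCsclRepB.lean
-- (imports of the standalone file: see Lines/Sketch17CS-LANDING.md)
-- ═════════════════════════════════════════════════════════════════════════════════════════════

/-!
# `ContinuumLegGivenGap` (stmt-QuantumFields-15828), line `Sketch`, reshape 17-CS, helper 10 of `stub_csclOfLock`:
# the representative as a complex cylinder observable; exact lattice translation; the class condition from supports

Sequel of `…CsclRep`: `cscl_rep_cylinderData` (measurable, bounded, cylinder on the class box `Λ`, and `Λ` has times in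
`[1, Nk + Rc]`), `cscl_rep_translate` (`X_{T_{a s e₀}H} = X_H ∘ τˢ` when the translated time support fits the box),
`cscl_cls_of_tsupport` (tuples carrying the lattice sum of a test function supported in
`{δ ≤ xᵢ₀ ≤ T₀, |xᵢⱼ| ≤ Rsp}` have `|xᵢⱼ| ≤ Nk`, `xᵢ₀ ≥ Rc + 2` once `a (Rc+2) ≤ δ`, `Rsp ≤ a Nk`, `T₀ ≤ a Nk`).
Registered anchor: `cscl_anchor_repB`. No definitions. [folklore]
-/

noncomputable section

open scoped SchwartzMap ComplexConjugate
open MeasureTheory Filter Topology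
open Literature.MathematicalPhysics.QuantumFieldTheory Literature.MathematicalPhysics.QuantumLattice
  Literature.MathematicalPhysics.AQFT
open Literature.Probability.LatticeModels (box mem_box Site)
open Summit.QuantumFields.YangMills.Theorems.ClusteringToYangMills.Reconstructible
open Summit.QuantumFields.YangMills.Cruxes.ContinuumLimitOnTrajectory.TwoOrbitSynchronisation (Arp.sum_boxFun_eq)

namespace Summit.QuantumFields.YangMills.Theorems.ContinuumLegGivenGap

section RepB

variable {G : Type} [Group G] [TopologicalSpace G] [IsTopologicalGroup G] [CompactSpace G]
  [MeasurableSpace G] [BorelSpace G] (r : LatticeRep G) (sch : SpeciesScheme (YMSpecies G)) (k : ℕ)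

omit [TopologicalSpace G] [IsTopologicalGroup G] [CompactSpace G] [BorelSpace G] in
/-- **Cylinder data of a complex observable with real local parts**: measurable, bounded, a cylinder on the common
support; and the class box has times in `[1, Nk + Rc]`. [folklore] -/
theorem cscl_rep_cylinderData {Nk Rc : ℕ} {X : LGConfig 4 G → ℂ} (O₁ O₂ : YMSpecies G)
    (h1 : O₁.supp = ((box 4 (Nk + Rc)).filter fun y => 1 ≤ y 0) ×ˢ (Finset.univ : Finset (Fin 4)))
    (h2 : O₂.supp = ((box 4 (Nk + Rc)).filter fun y => 1 ≤ y 0) ×ˢ (Finset.univ : Finset (Fin 4)))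
    (hX : ∀ V, X V = (O₁.F V : ℂ) + Complex.I * (O₂.F V : ℂ)) :
    Measurable X ∧ (∃ C : ℝ, ∀ U, ‖X U‖ ≤ C) ∧
      IsCylinder X (((box 4 (Nk + Rc)).filter fun y => 1 ≤ y 0) ×ˢ (Finset.univ : Finset (Fin 4))) ∧
      ∀ e ∈ ((box 4 (Nk + Rc)).filter fun y => 1 ≤ y 0) ×ˢ (Finset.univ : Finset (Fin 4)),
        (1 : ℤ) ≤ e.1 0 ∧ e.1 0 ≤ ((Nk + Rc : ℕ) : ℤ) := by
  have hXf : X = fun V => (O₁.F V : ℂ) + Complex.I * (O₂.F V : ℂ) := funext hX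
  obtain ⟨C1, hC1⟩ := O₁.bounded
  obtain ⟨C2, hC2⟩ := O₂.bounded
  refine ⟨?_, ⟨C1 + C2, fun U => ?_⟩, ?_, fun e he => ?_⟩
  · rw [hXf]
    exact (Complex.continuous_ofReal.measurable.comp O₁.measurable).add
      ((Complex.continuous_ofReal.measurable.comp O₂.measurable).const_mul _)
  · rw [hX]
    refine (norm_add_le _ _).trans (add_le_add ?_ ?_)
    · rw [Complex.norm_real, Real.norm_eq_abs]; exact hC1 U
    · rw [norm_mul, Complex.norm_I, one_mul, Complex.norm_real, Real.norm_eq_abs]; exact hC2 U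
  · intro U V hUV
    rw [hX, hX]
    have e1 : O₁.F U = O₁.F V := O₁.isCylinder (by rw [h1]; exact hUV)
    have e2 : O₂.F U = O₂.F V := O₂.isCylinder (by rw [h2]; exact hUV)
    rw [e1, e2]
  · simp only [Finset.mem_product, Finset.mem_filter, mem_box, Finset.mem_univ, and_true] at he
    obtain ⟨hb, ht⟩ := he
    have := (hb 0).2
    constructor <;> omega

omit [TopologicalSpace G] [IsTopologicalGroup G] [CompactSpace G] [BorelSpace G] in
/-- **Exact lattice translation of the representative**: `X_{T_{a s e₀}H}(V) = X_H(τˢ V)` for `H` supported at times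
of modulus `≤ T` with `T + a (s + 1) ≤ a L`. [folklore] -/
theorem cscl_rep_translate {m : ℕ} (H : 𝓢((Fin m → EuclideanSpace ℝ (Fin 4)), ℂ)) {T : ℝ} (sN : ℕ)
    (hH : ∀ x, H x ≠ 0 → ∀ i, |x i 0| ≤ T) (hfit : T + sch.a k * (sN + 1) ≤ sch.a k * sch.L k) (mb : ℝ)
    (P : LGConfig 4 G → ℝ) (V : LGConfig 4 G) :
    (∑ x : Fin m → ↥(box 4 (sch.L k)),
        translateMulti (EuclideanSpace.single 0 (sch.a k * sN)) H (fun i => sch.a k • siteToE (↑(x i) : Site 4)) *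
          ∏ i, ((P (configShift (-(↑(x i) : Site 4)) V) - mb : ℝ) : ℂ)) =
      ∑ x : Fin m → ↥(box 4 (sch.L k)), H (fun i => sch.a k • siteToE (↑(x i) : Site 4)) *
        ∏ i, ((P (configShift (-(↑(x i) : Site 4)) (configShift (-(Pi.single 0 (sN : ℤ))) V)) - mb : ℝ) : ℂ) := by
  classical
  set a : ℝ := sch.a k with ha_def
  have ha : 0 < a := sch.a_pos k
  set L := sch.L k
  set e : Site 4 := Pi.single 0 (sN : ℤ) with he
  have hsL := Arp.sum_boxFun_eq (L := L) (fun y : Fin m → Site 4 =>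
    translateMulti (EuclideanSpace.single 0 (a * sN)) H (fun i => a • siteToE (y i)) *
      ∏ i, ((P (configShift (-(y i)) V) - mb : ℝ) : ℂ))
  have hsR := Arp.sum_boxFun_eq (L := L) (fun y : Fin m → Site 4 =>
    H (fun i => a • siteToE (y i)) * ∏ i, ((P (configShift (-(y i)) (configShift (-e) V)) - mb : ℝ) : ℂ))
  simp only at hsL hsR
  rw [hsL, hsR]
  -- pointwise: translated argument and composed shifts
  have hpt : ∀ y : Fin m → Site 4,
      (fun i => a • siteToE (y i) - EuclideanSpace.single (0 : Fin 4) (a * (sN : ℝ))) =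
        fun i => a • siteToE (y i - e) := by
    intro y; funext i; ext j
    by_cases hj : j = 0
    · subst hj; simp [he, mul_sub]
    · simp [he, hj]
  have hshift : ∀ y : Site 4, configShift (-y) (configShift (-e) V) = configShift (-(y + e)) V := by
    intro y; funext q
    simp only [Literature.MathematicalPhysics.QuantumLattice.configShift_apply, neg_add, sub_neg_eq_add]
    congr 1; abel
  simp_rw [translateMulti_apply, hpt, hshift]
  -- support control: `H (a • (y - e)) ≠ 0` forces all time coordinates into the box before and after the shift
  have key : ∀ y : Fin m → Site 4, H (fun i => a • siteToE (y i)) ≠ 0 →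
      ∀ i, -(L : ℤ) ≤ y i 0 ∧ y i 0 + sN ≤ L := by
    intro y hy i
    have h1 := hH _ hy i
    simp only [PiLp.smul_apply, siteToE_apply, smul_eq_mul] at h1
    have h2 : |(y i 0 : ℝ)| * a ≤ T := by rw [abs_mul, abs_of_pos ha, mul_comm] at h1; exact h1
    have hT0 : 0 ≤ T := (by positivity : (0:ℝ) ≤ |(y i 0 : ℝ)| * a).trans h2
    have h3 : (|(y i 0 : ℝ)| + sN + 1) * a ≤ a * L := by nlinarith
    have h4 : |(y i 0 : ℝ)| + sN + 1 ≤ L := le_of_mul_le_mul_right (by nlinarith) ha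
    have h5 := abs_le.1 (show |(y i 0 : ℝ)| ≤ |(y i 0 : ℝ)| from le_rfl)
    constructor
    · have : -(L : ℝ) ≤ (y i 0 : ℝ) := by linarith [h5.1, neg_abs_le (y i 0 : ℝ)]
      exact_mod_cast this
    · have : (y i 0 : ℝ) + sN ≤ L := by linarith [le_abs_self (y i 0 : ℝ)]
      exact_mod_cast this
  have memiff : ∀ y : Fin m → Site 4, H (fun i => a • siteToE (y i)) ≠ 0 →
      (y ∈ Fintype.piFinset (fun _ : Fin m => box 4 L) ↔ (fun i => y i + e) ∈ Fintype.piFinset (fun _ : Fin m => box 4 L)) := by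
    intro y hy
    simp only [Fintype.mem_piFinset, mem_box]
    refine forall_congr' fun i => forall_congr' fun j => ?_
    by_cases hj : j = 0
    · subst hj
      obtain ⟨h0, h1⟩ := key y hy i
      simp only [Pi.add_apply, he, Pi.single_eq_same]
      omega
    · simp [he, hj]
  -- the bijection `x ↦ x - e` between the non-zero terms
  refine Finset.sum_bij_ne_zero (fun x _ _ => fun i => x i - e) (fun x hx hne => ?_)
    (fun x₁ _ _ x₂ _ _ h => ?_) (fun y hy hne => ?_) (fun x _ _ => by simp only [sub_add_cancel])
  · have hH' : H (fun i => a • siteToE (x i - e)) ≠ 0 := left_ne_zero_of_mul hne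
    have := (memiff (fun i => x i - e) hH').2 (by simpa using hx)
    exact this
  · funext i; have := congrFun h i; simpa using this
  · refine ⟨fun i => y i + e, (memiff y (left_ne_zero_of_mul hne)).1 hy, ?_, ?_⟩
    · simpa using hne
    · funext i; simp

omit [TopologicalSpace G] [IsTopologicalGroup G] [CompactSpace G] [BorelSpace G] in
/-- **The class condition from the supports.** [folklore] -/
theorem cscl_cls_of_tsupport {n : ℕ} {F : 𝓢((Fin n → EuclideanSpace ℝ (Fin 4)), ℂ)} {δ T₀ Rsp : ℝ} {Nk Rc : ℕ}
    (hF : tsupport (F : (Fin n → EuclideanSpace ℝ (Fin 4)) → ℂ) ⊆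
      {x | (∀ i, δ ≤ x i 0 ∧ x i 0 ≤ T₀) ∧ ∀ i j, |x i j| ≤ Rsp})
    (hδ : sch.a k * ((Rc : ℝ) + 2) ≤ δ) (hR : Rsp ≤ sch.a k * Nk) :
    ∀ x : Fin n → Site 4, F (fun i => sch.a k • siteToE (x i)) ≠ 0 →
      (∀ i j, |x i j| ≤ Nk) ∧ ∀ i, (Rc : ℤ) + 2 ≤ x i 0 := by
  intro x hx
  have ha : 0 < sch.a k := sch.a_pos k
  have hmem := hF (subset_tsupport _ (Function.mem_support.2 hx))
  simp only [Set.mem_setOf_eq, PiLp.smul_apply, siteToE_apply, smul_eq_mul] at hmem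
  obtain ⟨ht, hc⟩ := hmem
  refine ⟨fun i j => ?_, fun i => ?_⟩
  · have h1 := hc i j
    rw [abs_mul, abs_of_pos ha] at h1
    have h2 : (|(x i j : ℝ)|) ≤ Nk := le_of_mul_le_mul_left (h1.trans hR) ha
    have h3 : |((x i j : ℤ) : ℝ)| ≤ (Nk : ℝ) := h2
    rw [← Int.cast_abs] at h3
    exact_mod_cast h3
  · have h1 := (ht i).1
    have h2 : ((Rc : ℝ) + 2) ≤ (x i 0 : ℝ) := le_of_mul_le_mul_left (hδ.trans h1) ha
    exact_mod_cast h2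

end RepB

/-- **Registered anchor of this file** (closed elementary form, for the gate's `--supports` stub check): a point of
modulus at most `a N` in units of `a > 0` has modulus at most `N`. [folklore] -/
theorem cscl_anchor_repB :
    ∀ (a R : ℝ) (N : ℕ) (z : ℤ), 0 < a → |a * z| ≤ R → R ≤ a * N → |z| ≤ N := by
  intro a R N z ha h1 h2
  rw [abs_mul, abs_of_pos ha] at h1
  have h3 : (|(z : ℝ)|) ≤ N := le_of_mul_le_mul_left (h1.trans h2) ha
  rw [← Int.cast_abs] at h3
  exact_mod_cast h3

end Summit.QuantumFields.YangMills.Theorems.ContinuumLegGivenGap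

end


-- ═════════════════════════════════════════════════════════════════════════════════════════════
-- FILE: Summits/QuantumFields/YangMills/Theorems/ConvexGribovBodyContinuumLegGivenGapCsclReduce.lean
-- (imports of the standalone file: see Lines/Sketch17CS-LANDING.md)
-- ═════════════════════════════════════════════════════════════════════════════════════════════

/-!
# `ContinuumLegGivenGap` (stmt-QuantumFields-15828), line `Sketch`, reshape 17-CS, helper 7 of `stub_csclOfLock`:
# `HasCSClustering` of the canonical scheme from the Cauchy–Schwarz inequality for sums of curvature tensors

The converse bookkeeping of the landed `clustersCS_sum`: `SpeciesScheme.HasCSClustering r (canon r sch) Δ` (the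
lattice statement `ClustersCS` over ALL species strings and all finite families of slab-ordered real factor data)
follows from the inequality in `curvDistribution` form for explicit finite sums `P = ∑ cᵢ gᵢ`, `Q = ∑ c'ⱼ g'ⱼ` of
slab-ordered real product tensors (`cscl_hasCSClustering_of_sums`): strings touching a species other than the
curvature contribute nothing (`latticeSchwinger_canon_eq_zero`, the species-zeroing licence of `canon`), and on
curvature strings every term is a canonical curvature distribution (`latticeSchwinger_canon_eq_curvDistribution`),
the sums expanding sesquilinearly (`curvCLM`). Registered anchor: `cscl_anchor_reduce`. No definitions. [folklore]
-/

noncomputable section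

open scoped SchwartzMap ComplexConjugate
open MeasureTheory Filter Topology
open Literature.MathematicalPhysics.QuantumFieldTheory Literature.MathematicalPhysics.QuantumLattice
  Literature.MathematicalPhysics.AQFT Literature.Probability.LatticeModels
open Summit.QuantumFields.YangMills.Cruxes.ContinuumLimitOnTrajectory.TwoOrbitSynchronisation
  (curvDistribution curvNPoint canon curvCLM curvCLM_apply curvDistribution_tensor latticeSchwinger_canon_curv
   latticeSchwinger_canon_eq_zero)
open Summit.QuantumFields.YangMills.Cruxes.LatticeGapOnTrajectory.OrbitKantorovichFiniteSize.Transfer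
  (isTensorOf_osAdjoint_appendTensor_translateMulti)

namespace Summit.QuantumFields.YangMills.Theorems.ContinuumLegGivenGap

section Reduce

variable {G : Type} [Group G] [TopologicalSpace G] [IsTopologicalGroup G] [CompactSpace G]
  [MeasurableSpace G] [BorelSpace G] (r : LatticeRep G) (sch : SpeciesScheme (YMSpecies G))

/-- A reversed string that is not constantly the curvature touches another species. [folklore] -/
theorem cscl_append_left_ne {n m : ℕ} {σ : Fin n → YMSpecies G} {i : Fin n} (hi : σ i ≠ r.curvature)
    (σ' : Fin m → YMSpecies G) :
    Fin.append (σ ∘ Fin.rev) σ' (Fin.castAdd m (Fin.rev i)) ≠ r.curvature := by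
  simpa [Fin.append_left] using hi

/-- An appended string whose right part is not constantly the curvature touches another species. [folklore] -/
theorem cscl_append_right_ne {n m : ℕ} (σ : Fin n → YMSpecies G) {σ' : Fin m → YMSpecies G} {j : Fin m}
    (hj : σ' j ≠ r.curvature) :
    Fin.append (σ ∘ Fin.rev) σ' (Fin.natAdd n j) ≠ r.curvature := by
  simpa [Fin.append_right] using hj

/-- **`HasCSClustering` of the canonical scheme from the inequality for sums of curvature tensors.** [folklore] -/
theorem cscl_hasCSClustering_of_sums {Δ : ℝ}
    (H : ∀ (n m : ℕ), n ≠ 0 → m ≠ 0 → ∀ (N N' : ℕ) (c : Fin N → ℂ) (c' : Fin N' → ℂ)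
      (g : Fin N → 𝓢((Fin n → EuclideanSpace ℝ (Fin 4)), ℂ)) (g' : Fin N' → 𝓢((Fin m → EuclideanSpace ℝ (Fin 4)), ℂ))
      (p : Fin N → Fin n → 𝓢(EuclideanSpace ℝ (Fin 4), ℝ)) (q : Fin N' → Fin m → 𝓢(EuclideanSpace ℝ (Fin 4), ℝ)),
      (∀ i, IsTensorOf (g i) fun l => ofRealTest (p i l)) → (∀ i, IsSlabOrdered (p i)) →
      (∀ j, IsTensorOf (g' j) fun l => ofRealTest (q j l)) → (∀ j, IsSlabOrdered (q j)) →
      ∀ t : ℝ, 0 ≤ t → ∀ ε : ℝ, 0 < ε → ∀ᶠ k in atTop,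
        ‖curvDistribution r sch k (n + m) ((osAdjoint (∑ i, c i • g i)).appendTensor
              (translateMulti (EuclideanSpace.single 0 t) (∑ j, c' j • g' j))) -
            curvDistribution r sch k n (osAdjoint (∑ i, c i • g i)) * curvDistribution r sch k m (∑ j, c' j • g' j)‖ ≤
          Real.exp (-Δ * t) *
              Real.sqrt ‖curvDistribution r sch k (n + n) ((osAdjoint (∑ i, c i • g i)).appendTensor (∑ i, c i • g i))‖ *
              Real.sqrt ‖curvDistribution r sch k (m + m)
                ((osAdjoint (∑ j, c' j • g' j)).appendTensor (∑ j, c' j • g' j))‖ + ε) :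
    SpeciesScheme.HasCSClustering r (canon r sch) Δ := by
  intro n m hn hm σ σ' N N' c c' p q hp hq t ht ε hε
  -- strings touching another species contribute nothing
  by_cases hσ : ∃ i, σ i ≠ r.curvature
  · obtain ⟨i, hi⟩ := hσ
    refine Eventually.of_forall fun k => ?_
    have h1 : ∀ (i' : Fin N) (j : Fin N'), latticeSchwinger r.ρ (canon r sch) (fun s => s.F) k (n + m)
        (Fin.append (σ ∘ Fin.rev) σ') (Fin.append (fun l => thetaTest 4 (p i' (Fin.rev l)))
          (fun l => translateTest (EuclideanSpace.single 0 t) (q j l))) = 0 := fun i' j =>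
      latticeSchwinger_canon_eq_zero r sch k (n + m) _ _ (cscl_append_left_ne r hi σ')
    have h2 : ∀ i' : Fin N, latticeSchwinger r.ρ (canon r sch) (fun s => s.F) k n (σ ∘ Fin.rev)
        (fun l => thetaTest 4 (p i' (Fin.rev l))) = 0 := fun i' =>
      latticeSchwinger_canon_eq_zero r sch k n _ _ (i := Fin.rev i) (by simpa using hi)
    simp only [h1, h2, Complex.ofReal_zero, zero_mul, sub_zero, mul_zero, Finset.sum_const_zero, norm_zero]
    positivity
  by_cases hσ' : ∃ j, σ' j ≠ r.curvature
  · obtain ⟨j, hj⟩ := hσ'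
    refine Eventually.of_forall fun k => ?_
    have h1 : ∀ (i : Fin N) (j' : Fin N'), latticeSchwinger r.ρ (canon r sch) (fun s => s.F) k (n + m)
        (Fin.append (σ ∘ Fin.rev) σ') (Fin.append (fun l => thetaTest 4 (p i (Fin.rev l)))
          (fun l => translateTest (EuclideanSpace.single 0 t) (q j' l))) = 0 := fun i j' =>
      latticeSchwinger_canon_eq_zero r sch k (n + m) _ _ (cscl_append_right_ne r σ hj)
    have h3 : ∀ j' : Fin N', latticeSchwinger r.ρ (canon r sch) (fun s => s.F) k m σ' (q j') = 0 := fun j' =>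
      latticeSchwinger_canon_eq_zero r sch k m _ _ hj
    simp only [h1, h3, Complex.ofReal_zero, sub_zero, mul_zero, Finset.sum_const_zero, norm_zero]
    positivity
  push Not at hσ hσ'
  obtain rfl : σ = fun _ => r.curvature := funext hσ
  obtain rfl : σ' = fun _ => r.curvature := funext hσ'
  -- curvature strings: the real product tensors `gᵢ = ⊗ pᵢ`, `g'ⱼ = ⊗ qⱼ`
  set g : Fin N → 𝓢((Fin n → EuclideanSpace ℝ (Fin 4)), ℂ) := fun i => SchwartzMap.tensorFin n fun l => ofRealTest (p i l)
  set g' : Fin N' → 𝓢((Fin m → EuclideanSpace ℝ (Fin 4)), ℂ) := fun j => SchwartzMap.tensorFin m fun l => ofRealTest (q j l)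
  have hpT : ∀ i, IsTensorOf (g i) fun l => ofRealTest (p i l) := fun i => isTensorOf_tensorFin _
  have hqT : ∀ j, IsTensorOf (g' j) fun l => ofRealTest (q j l) := fun j => isTensorOf_tensorFin _
  filter_upwards [H n m hn hm N N' c c' g g' p q hpT hp hqT hq t ht ε hε] with k hk
  have key := latticeSchwinger_canon_eq_curvDistribution r sch k
  simp only [fun (i : Fin N) (j : Fin N') => key (n + m) _ (append_const_curvature r) _
      (isTensorOf_osAdjoint_appendTensor_translateMulti (hpT i) (hqT j) (EuclideanSpace.single 0 t)),
    fun (i : Fin N) => key n ((fun _ : Fin n => r.curvature) ∘ Fin.rev) (fun _ => rfl) _ (hpT i).osAdjoint,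
    fun (j : Fin N') => key m (fun _ : Fin m => r.curvature) (fun _ => rfl) _ (hqT j),
    fun (i i' : Fin N) => key (n + n) _ (append_const_curvature r) _
      (by simpa only [append_ofRealTest] using (hpT i).osAdjoint.appendTensor (hpT i')),
    fun (j j' : Fin N') => key (m + m) _ (append_const_curvature r) _
      (by simpa only [append_ofRealTest] using (hqT j).osAdjoint.appendTensor (hqT j'))]
  simp only [← curvCLM_apply] at hk ⊢
  rw [map_sum (translateMulti (EuclideanSpace.single (0 : Fin 4) t)),
    Finset.sum_congr rfl fun j _ => map_smul (translateMulti (EuclideanSpace.single (0 : Fin 4) t)) _ _] at hk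
  simp only [apply_osAdjoint_appendTensor_sum_smul, apply_osAdjoint_sum_smul, apply_sum_smul] at hk
  convert hk using 3
  rw [Finset.sum_mul_sum, ← Finset.sum_sub_distrib]
  refine Finset.sum_congr rfl fun i _ => ?_
  rw [← Finset.sum_sub_distrib]
  exact Finset.sum_congr rfl fun j _ => by ring

end Reduce

/-- **Registered anchor of this file** (closed form of `cscl_append_right_ne`, for the gate's `--supports` stub check).
[folklore] -/
theorem cscl_anchor_reduce :
    ∀ (G : Type) [Group G] [TopologicalSpace G] [IsTopologicalGroup G] [CompactSpace G] [MeasurableSpace G]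
      [BorelSpace G] (r : LatticeRep G) (n m : ℕ) (σ : Fin n → YMSpecies G) (σ' : Fin m → YMSpecies G) (j : Fin m),
      σ' j ≠ r.curvature → Fin.append (σ ∘ Fin.rev) σ' (Fin.natAdd n j) ≠ r.curvature :=
  fun _ _ _ _ _ _ _ r _ _ σ _ _ hj => cscl_append_right_ne r σ hj

end Summit.QuantumFields.YangMills.Theorems.ContinuumLegGivenGap

end
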